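/-
Copyright (c) 2026. All rights reserved.
Released under Apache 2.0 license as described in the file LICENSE.
-/
import Literature.AlgebraicGeometry.Pohlmann1968.DegenerateCMTypesAbelianCMFieldExponentTwicePrimeSquare
import Literature.NumberTheory.ComplexMultiplication.DegenerateCMTypesAbelianKernelsIndexFourMulPrimePower
import HarnessLib

/-!
# ABELIAN CM fields with Galois group of EXPONENT `4p²` (`p` an odd prime): the rank of every CM type is
# `[K:ℚ]/2 + 1 − b − 2e₄ − (p−1)e_{2p} − 2(p−1)e_{4p} − p(p−1)e_{2p²} − 2p(p−1)e_{4p²}`; the nondegeneracy criterion and the Hodge conjecture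
# for all powers off the six lists; the cyclic levels `ℚ(ζ₃₇) = ℚ(ζ₇₄)` (`Rank + 2e₄ + 4e₁₂ + 12e₃₆ = 19`)

Topic `Literature/AlgebraicGeometry/Pohlmann1968` (namespace `Literature.AlgebraicGeometry.Pohlmann1968.ExponentFourTimesPrimeSquare`); cell
`pub-hodgecm2` (COR-CM), KEPT Literature lane `lit-deligne-3` gen 64, file F64e (with F64c `ExponentTwicePrimeSquare` — levels `57, 76, 108` —
and the level `63` appended to F64a `ExponentTwicePrime`, this COMPLETES the lane's «φ(N) = 36» band: `37, 57, 63, 74, 76, 108, 114, 126`;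
the group-theoretic input is F64d `NumberTheory/ComplexMultiplication/DegenerateCMTypesAbelianKernelsIndexFourMulPrimePower`, the kernels of
index `4p^{j+1}`).  KERNEL ONLY: theorems; no `def`, no named fact, no instance, no notation (D-0014 ∕ D-0026 net debt `0`).  HC_CM is NOT
proved here or anywhere in the lane.

## Mathematics

T. Kubota [Kubota1965], §4 LEMMA 2 (defect = number of vanishing odd characters), grouped by KERNEL (S. P. White; tree
`DegenerateCMTypesAbelianKernels.typeRank_add_sum_totient_eq`).  If `g^{4p²} = 1` on `G = Gal(K/ℚ)` then an admissible kernel (`ρ ∉ H`,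
`G/H` cyclic) has index `2, 4, 2p, 4p, 2p²` or `4p²` (`index_eq_of_isCyclic_quotient`: `[G:H]` divides `4p²` and is even), and the tree
DECIDES all six: index `2` — even split (Weil type over the imaginary quadratic `K^H`, Dodson [Dodson1984] §3.1.1); index `4` with cyclic
quotient — half of every coset (`…IndexFour`, Yanai–Gordon [Gordon1999HodgeAVSurvey] 9.4.3); index `2p^{a+1}` (`a = 0, 1`) and `4p`, `4p²`
with cyclic quotient — `S` EQUIDISTRIBUTED along the subgroup of order `p` of `G/H` (`#(S ∩ gxH) = #(S ∩ gH)` for `x^p ∈ H`; Hazama's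
Lemma 4.6.1 mechanism [Hazama2003CyclicCM], Dodson [Dodson1987] Prop. 4.4; tree `…equidistributed_of_index`, `…_of_index_four_mul`,
`…_of_index_four_mul_primePow`).  Every index-`2p` subgroup has cyclic quotient; at index `4, 4p, 2p², 4p²` the cyclicity clause is part of
the count.  Hence, EXACTLY,

  `[K:ℚ]/2 + 1 − Rank(Φ) = b + 2·e₄ + (p − 1)·e_{2p} + 2(p − 1)·e_{4p} + p(p − 1)·e_{2p²} + 2p(p − 1)·e_{4p²}`

with `b` = #imaginary quadratic subfields over which `Φ` is balanced, `e₄` = #CM subfields `F` with `Gal(F/ℚ) ≅ ℤ/4` every embedding of which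
has `[K:F]/2` extensions in `Φ`, `e_{2p}` = #CM subfields of degree `2p` over which `Φ` is LEVEL of exponent `p`, and `e_{4p}, e_{2p²}, e_{4p²}` =
#CM subfields of degree `4p, 2p², 4p²` with CYCLIC Galois group over which `Φ` is level of exponent `p`.

* §1 GROUP LEVEL: **`index_eq_of_isCyclic_quotient`**, **`typeRank_add_card_kernels_eq`** (the six-term formula), **`typeRank_eq_iff`**.
* §2 FIELD LEVEL: `cmTypeRank_add_card_kernels_eq` (on `Gal`), **`cmTypeRank_add_ncard_subfields_eq`** (THE INTRINSIC RANK FORMULA),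
  **`isNondegenerate_iff_forall_intermediateField`**, `not_isNondegenerate_of_level_of_isCyclic`.
* §3 ABELIAN VARIETIES: `B•(Aⁿ) ⊗ ℂ = D•(Aⁿ) ⊗ ℂ` and the Hodge conjecture for every power of every realisation of a type off the six lists
  (**`hodgeConjectureFor_pow_of_forall_intermediateField`**, `hodgeClassSpan_pow_eq_divisorClassesSpan_of_forall_intermediateField`,
  `not_exists_exceptional_pow_of_forall_intermediateField`) — UNCONDITIONAL.
* §4 CYCLOTOMIC FIELDS `ℚ(ζ_q)` with `u^{4p²} = 1` on `(ℤ/q)ˣ` (`…_of_isCyclotomicExtension`); the levels `37, 74` (`(ℤ/q)ˣ ≅ ℤ/36` cyclic,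
  `φ = 36`; `u³⁶ = 1` by Euler, `ZMod.pow_totient`): **`cmTypeRank_add_ncard_subfields_thirtySeven ∕ seventyFour`**
  (`Rank(Φ) + b + 2e₄ + 2e₆ + 4e₁₂ + 6e₁₈ + 12e₃₆ = 19` for EVERY CM type; on this cyclic field `b = e₆ = e₁₈ = 0`, the subfields of degree
  `2, 6, 18` being real), **`hodgeConjectureFor_pow_of_forall_thirtySeven ∕ seventyFour`**.

NUMERICAL PICTURE (offline census of this seat, NOT a theorem of this file; `lane/census_np.py 36 18`, kit job `j338402`): for `G = ℤ/36 ∋ ρ = 18`,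
`n = 18`, `2¹⁸ = 262144` types: PRIMITIVE `262080` types — `258948` NONDEGENERATE (rank `19`) and `3132` with `e₁₂ = 1` (rank `15`); imprimitive
`64` types — `60` with `e₃₆ = 1` only (rank `7`) and `4` with `e₁₂ = e₃₆ = 1` (rank `3`).  So `e₄ = 0` on every type of `ℚ(ζ₃₇)` (an index-`4`
kernel `H` has `|H| = 9` odd: no coset can be halved), the only degenerate PRIMITIVE types are the `3132` level over the cyclic CM subfield of
degree `12` (`B¹⁵ ≠ D¹⁵`-type defects of codimension `4`), and §3 covers exactly the `258948` nondegenerate types (simple CM `18`-folds with `B = D`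
on all powers).

PRESEARCH (lane rule): as for the neighbours (corpus hybrid + vector; galaxy «degenerate CM type | degenerate CM-type | nondegenerate CM type»,
all stars: no statement of the formula) — Kubota's Lemma 2 regrouped by kernels with the six vanishing criteria; recorded as the lane's own
elementary theorem with the printed ingredients cited at each statement.

HONEST REGISTER.  Everything here is unconditional and elementary given the tree's Kubota ∕ Hazama ∕ Pohlmann theorems.  Nothing is claimed for
the DEGENERATE types (for them `Bᵐ ⊋ Dᵐ` in some degree — Lenstra — and the Hodge conjecture is OPEN in print); HC_CM is NOT proved and not used.

## References

* [Kubota1965] T. Kubota, *On the field extension by complex multiplication*, Trans. AMS 118 (1965), §4 Lemma 2.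
* [White1993SporadicCycles] S. P. White, *Sporadic cycles on CM abelian varieties*, Compositio Math. 88 (1993), §4, proof of Lemma 3 (p. 131).
* [Dodson1984] B. Dodson, *The structure of Galois groups of CM-fields*, Trans. AMS 283 (1984), §3.1.1 Theorem.
* [Dodson1987] B. Dodson, *On the Mumford–Tate group of an abelian variety with complex multiplication*, J. Algebra 111 (1987), Prop. 4.4.
* [Hazama2003CyclicCM] F. Hazama, *Hodge cycles on abelian varieties with complex multiplication by cyclic CM-fields*, J. Math. Sci. Univ.
  Tokyo 10 (2003), Prop. 4.3, Lemma 4.6.1.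
* [Gordon1999HodgeAVSurvey] B. B. Gordon, *A survey of the Hodge conjecture for abelian varieties*, 5.13 (ii), Thm. 6.4, §9.3, 9.4.1, 9.4.3.
* [Yanai2015IndexDegeneracy] H. Yanai, *On the index of degeneracy of a CM-type*, Thm. 4.1 (proof, p. 818).
* [Washington1997] L. C. Washington, *Introduction to Cyclotomic Fields*, Ch. 2, Thm. 2.5.
* [Deligne2000] P. Deligne, *The Hodge conjecture* (Clay, 2000), §1.

## Provenance

Cell `pub-hodgecm2` (COR-CM), KEPT Literature lane `lit-deligne-3` gen 64 (claim ABELIAN-EXPONENT-4P2-RANK-FORMULA; count-neutral, own lane), file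
F64e; neighbours cited by name, nothing restated: `DegenerateCMTypesAbelianKernels{,IndexFour,IndexFourMulPrime,IndexFourMulPrimePower}` (group
level), `DegenerateCMTypesAbelianCMFieldCyclicSubfields` ∕ `…CyclicQuarticSubfields` (`card_indexTwo_eq_ncard_weilQuadratic`,
`card_indexFour_eq_ncard_weilQuartic`), `…ExponentTwicePrime` (`card_index_eq_ncard_level`), `…ExponentFourTimesPrime`
(`card_index_isCyclic_eq_ncard_level`, `cm_abelian_pow_eq_one_of_isCyclotomicExtension`), `NondegenerateCMTypeDivisorClasses`
(`IsNondegenerate.hodgeClassSpan_pow_eq_divisorClassesSpan`).  Theorems only; net Literature debt 0.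
-/

noncomputable section

open scoped BigOperators NumberField IsMulCommutative Classical
open NumberField IntermediateField

namespace Literature.AlgebraicGeometry.Pohlmann1968

namespace ExponentFourTimesPrimeSquare

open Literature.NumberTheory.ComplexMultiplication
open Literature.NumberTheory.ComplexMultiplication.CMNumbers
open Literature.AlgebraicGeometry.Motives (CMType)
open Literature.AlgebraicGeometry.Pohlmann1968.CyclicTwoOddPrimes (isCMTypeWith_galType cmTypeRank_eq_typeRank_galType)
open Literature.AlgebraicGeometry.Pohlmann1968.AbelianKernels
open Literature.AlgebraicGeometry.Pohlmann1968.ExponentTwicePrime (card_index_eq_ncard_level)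
open Literature.AlgebraicGeometry.Pohlmann1968.ExponentFourTimesPrime (card_index_isCyclic_eq_ncard_level
  cm_abelian_pow_eq_one_of_isCyclotomicExtension)

/-! ## §0 Arithmetic helper -/

/-- If `a + b + 2c + kd + 2ke + lf + 2lg = n` with `k, l ≠ 0` (naturals) then `a = n ↔ b = c = d = e = f = g = 0`. [folklore] -/
private theorem eq_iff_of_add_eq₄ₚ₂ {a b c d e f g k l n : ℕ} (hk : k ≠ 0) (hl : l ≠ 0)
    (h : a + b + 2 * c + k * d + 2 * k * e + l * f + 2 * l * g = n) :
    a = n ↔ b = 0 ∧ c = 0 ∧ d = 0 ∧ e = 0 ∧ f = 0 ∧ g = 0 := by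
  set u := k * d with hu
  set v := 2 * k * e with hv
  set w := l * f with hw
  set z := 2 * l * g with hz
  have hu0 : u = 0 ↔ d = 0 := by rw [hu, Nat.mul_eq_zero]; omega
  have hv0 : v = 0 ↔ e = 0 := by rw [hv, Nat.mul_eq_zero, Nat.mul_eq_zero]; omega
  have hw0 : w = 0 ↔ f = 0 := by rw [hw, Nat.mul_eq_zero]; omega
  have hz0 : z = 0 ↔ g = 0 := by rw [hz, Nat.mul_eq_zero, Nat.mul_eq_zero]; omega
  constructor
  · intro ha
    exact ⟨by omega, by omega, hu0.1 (by omega), hv0.1 (by omega), hw0.1 (by omega), hz0.1 (by omega)⟩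
  · rintro ⟨hb, hc, hd, he, hf, hg⟩
    have := hu0.2 hd; have := hv0.2 he; have := hw0.2 hf; have := hz0.2 hg
    omega

/-! ## §1 Group level: in exponent `4p²` every admissible kernel has index `2, 4, 2p, 4p, 2p²` or `4p²` -/

section Group

variable {G : Type*} [CommGroup G] {p : ℕ}

/-- A commutative group of order `2p` (`p` an odd prime) is cyclic. [folklore] -/
private theorem isCyclic_of_card_eq_two_mul₄ₚ₂ [Finite G] [hp : Fact p.Prime] (hp2 : p ≠ 2) (hG : Nat.card G = 2 * p) :
    IsCyclic G := by
  haveI : Fact (Nat.Prime 2) := ⟨Nat.prime_two⟩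
  obtain ⟨x, hx⟩ := exists_prime_orderOf_dvd_card' (G := G) 2 (by rw [hG]; exact dvd_mul_right 2 p)
  obtain ⟨y, hy⟩ := exists_prime_orderOf_dvd_card' (G := G) p (by rw [hG]; exact dvd_mul_left p 2)
  have hcop : Nat.Coprime (orderOf x) (orderOf y) := by
    rw [hx, hy]; exact (Nat.coprime_primes Nat.prime_two hp.out).2 hp2.symm
  exact isCyclic_of_orderOf_eq_card (x * y)
    (by rw [(Commute.all x y).orderOf_mul_eq_mul_orderOf_of_coprime hcop, hx, hy, hG])

/-- **In a commutative group with `g^{4p²} = 1` for all `g` (`p` an odd prime), a subgroup `H` missing an involution `ρ` and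
with CYCLIC quotient has index `2, 4, 2p, 4p, 2p²` or `4p²`**: `|G/H|` divides `4p²` and is even. [cite: Kubota1965, §4 Lemma 2]
[cite: White1993SporadicCycles, §4, proof of Lemma 3 (p. 131)] -/
theorem index_eq_of_isCyclic_quotient [hp : Fact p.Prime] (hp2 : p ≠ 2) (hexp : ∀ g : G, g ^ (4 * p ^ 2) = 1)
    {H : Subgroup G} {ρ : G} (hρH : ρ ∉ H) (hρ2 : ρ * ρ = 1) (hcyc : IsCyclic (G ⧸ H)) :
    H.index = 2 ∨ H.index = 4 ∨ H.index = 2 * p ∨ H.index = 4 * p ∨ H.index = 2 * p ^ 2 ∨ H.index = 4 * p ^ 2 := by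
  haveI := hcyc
  have hdvd : H.index ∣ 4 * p ^ 2 := by
    rw [Subgroup.index_eq_card, ← IsCyclic.exponent_eq_card]
    exact Monoid.exponent_dvd_of_forall_pow_eq_one fun q => QuotientGroup.induction_on q fun g => by
      rw [← QuotientGroup.mk_pow, hexp, QuotientGroup.mk_one]
  have hρ1 : (ρ : G ⧸ H) ≠ 1 := fun h => hρH ((QuotientGroup.eq_one_iff ρ).1 h)
  have hord : orderOf (ρ : G ⧸ H) = 2 := by
    haveI : Fact (Nat.Prime 2) := ⟨Nat.prime_two⟩
    refine orderOf_eq_prime ?_ hρ1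
    rw [pow_two, ← QuotientGroup.mk_mul, hρ2, QuotientGroup.mk_one]
  have h2 : 2 ∣ H.index := by rw [Subgroup.index_eq_card, ← hord]; exact orderOf_dvd_natCard _
  have hp2' : ¬ 2 ∣ p := fun h => hp2 ((Nat.prime_dvd_prime_iff_eq Nat.prime_two hp.out).1 h).symm
  obtain ⟨d₁, d₂, hd₁, hd₂, hdeq⟩ := Nat.dvd_mul.1 hdvd
  have hd₁' : d₁ ∣ 2 ^ 2 := by rw [show (2 : ℕ) ^ 2 = 4 by norm_num]; exact hd₁
  obtain ⟨i, hi, rfl⟩ := (Nat.dvd_prime_pow Nat.prime_two).1 hd₁'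
  obtain ⟨k, hk, rfl⟩ := (Nat.dvd_prime_pow hp.out).1 hd₂
  have hpk : ¬ 2 ∣ p ^ k := fun h => hp2' (Nat.Prime.dvd_of_dvd_pow Nat.prime_two h)
  interval_cases i
  · exfalso; rw [← hdeq, pow_zero, one_mul] at h2; exact hpk h2
  · interval_cases k
    · exact Or.inl (by rw [← hdeq, pow_zero, pow_one, mul_one])
    · exact Or.inr (Or.inr (Or.inl (by rw [← hdeq, pow_one, pow_one])))
    · exact Or.inr (Or.inr (Or.inr (Or.inr (Or.inl (by rw [← hdeq, pow_one])))))
  · interval_cases k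
    · exact Or.inr (Or.inl (by rw [← hdeq, pow_zero, mul_one]; norm_num))
    · exact Or.inr (Or.inr (Or.inr (Or.inl (by rw [← hdeq, pow_one]; norm_num))))
    · exact Or.inr (Or.inr (Or.inr (Or.inr (Or.inr (by rw [← hdeq]; norm_num)))))

variable [Fintype G] [DecidableEq G]

/-- **THE RANK OF A CM TYPE IN EXPONENT `4p²` (group level).**  Let `G` be a finite commutative group with `g^{4p²} = 1` for all `g`
(`p` an odd prime), `ρ ∈ G` and `T` a CM type (`T ⊔ ρT = G`).  Then

  `rank(T) + #B₂ + 2·#B₄ + (p−1)·#B_{2p} + 2(p−1)·#B_{4p} + p(p−1)·#B_{2p²} + 2p(p−1)·#B_{4p²} = |G|/2 + 1`,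

`B₂` = index-`2` subgroups `H ∌ ρ` splitting `T` evenly; `B₄` = index-`4` subgroups `H ∌ ρ` with CYCLIC quotient met in half of every
coset; `B_{2p}` (all with cyclic quotient), `B_{4p}`, `B_{2p²}`, `B_{4p²}` (with CYCLIC quotient) = the subgroups `H ∌ ρ` of that index at which
`T` is EQUIDISTRIBUTED along the subgroup of order `p` of `G/H` (`#(T ∩ gxH) = #(T ∩ gH)` for all `g` and all `x` with `x^p ∈ H`).
Kubota's defect `Σ_H φ([G:H])` (tree `AbelianKernels.typeRank_add_sum_totient_eq`) with the six vanishing criteria of the tree: index `2`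
(`…iff_of_index_two`), `4` (`…iff_of_index_four`), `2p^{a+1}` (`…equidistributed_of_index`, `a = 0, 1`), `4p`
(`…equidistributed_of_index_four_mul`), `4p²` (`…equidistributed_of_index_four_mul_primePow`); `φ = 1, 2, p−1, 2(p−1), p(p−1), 2p(p−1)`.
[cite: Kubota1965, §4 Lemma 2] [cite: Hazama2003CyclicCM, Prop. 4.3 and Lemma 4.6.1] [cite: Dodson1984, §3.1.1 Theorem]
[cite: Dodson1987, Prop. 4.4] [cite: Gordon1999HodgeAVSurvey, 9.4.3] -/
theorem typeRank_add_card_kernels_eq [hp : Fact p.Prime] (hp2 : p ≠ 2) {ρ : G} {T : Finset G}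
    (h : IsCMTypeWith ρ (T : Set G)) (hexp : ∀ g : G, g ^ (4 * p ^ 2) = 1) :
    typeRank G (T : Set G) +
      ((Finset.univ : Finset (Subgroup G)).filter fun H : Subgroup G => ρ ∉ H ∧ H.index = 2 ∧
        (T.filter fun s => s ∈ H).card = (T.filter fun s => s ∉ H).card).card +
      2 * ((Finset.univ : Finset (Subgroup G)).filter fun H : Subgroup G => ρ ∉ H ∧ H.index = 4 ∧ IsCyclic (G ⧸ H) ∧
        ∀ g : G, 2 * ((T.filter fun s => g⁻¹ * s ∈ H).card) = Nat.card H).card +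
      (p - 1) * ((Finset.univ : Finset (Subgroup G)).filter fun H : Subgroup G => ρ ∉ H ∧ H.index = 2 * p ∧
        ∀ x : G, x ^ p ∈ H → ∀ g : G,
          (T.filter fun s => (g * x)⁻¹ * s ∈ H).card = (T.filter fun s => g⁻¹ * s ∈ H).card).card +
      2 * (p - 1) * ((Finset.univ : Finset (Subgroup G)).filter fun H : Subgroup G => ρ ∉ H ∧ H.index = 4 * p ∧ IsCyclic (G ⧸ H) ∧
        ∀ x : G, x ^ p ∈ H → ∀ g : G,
          (T.filter fun s => (g * x)⁻¹ * s ∈ H).card = (T.filter fun s => g⁻¹ * s ∈ H).card).card +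
      p * (p - 1) * ((Finset.univ : Finset (Subgroup G)).filter fun H : Subgroup G => ρ ∉ H ∧ H.index = 2 * p ^ 2 ∧ IsCyclic (G ⧸ H) ∧
        ∀ x : G, x ^ p ∈ H → ∀ g : G,
          (T.filter fun s => (g * x)⁻¹ * s ∈ H).card = (T.filter fun s => g⁻¹ * s ∈ H).card).card +
      2 * (p * (p - 1)) * ((Finset.univ : Finset (Subgroup G)).filter fun H : Subgroup G => ρ ∉ H ∧ H.index = 4 * p ^ 2 ∧ IsCyclic (G ⧸ H) ∧
        ∀ x : G, x ^ p ∈ H → ∀ g : G,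
          (T.filter fun s => (g * x)⁻¹ * s ∈ H).card = (T.filter fun s => g⁻¹ * s ∈ H).card).card =
      Fintype.card G / 2 + 1 := by
  have hρ2 : ρ * ρ = 1 := by simpa [smul_eq_mul] using h.invol (1 : G)
  have hp3 : 3 ≤ p := by
    have := hp.out.two_le
    rcases Nat.lt_or_ge 2 p with h' | h'
    · omega
    · exfalso; exact hp2 (le_antisymm h' this)
  have hq : p * 3 ≤ p ^ 2 := by rw [pow_two]; exact Nat.mul_le_mul_left p hp3
  have h2p : Nat.Coprime 2 p := (Nat.coprime_primes Nat.prime_two hp.out).2 hp2.symm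
  have h4p : Nat.Coprime 4 p := by rw [show (4 : ℕ) = 2 ^ 2 by norm_num]; exact h2p.pow_left 2
  have h2p2 : Nat.Coprime 2 (p ^ 2) := h2p.pow_right 2
  have h4p2 : Nat.Coprime 4 (p ^ 2) := h4p.pow_right 2
  have key := CyclicCMType.AbelianKernels.typeRank_add_sum_totient_eq h
  set A := (Finset.univ : Finset (Subgroup G)).filter (fun H => ρ ∉ H ∧ IsCyclic (G ⧸ H) ∧
    ∀ χ : AddChar (Additive G) ℂ, (∀ g : G, χ (Additive.ofMul g) = 1 ↔ g ∈ H) →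
      ∑ s ∈ T, χ (Additive.ofMul s) = 0) with hA
  set B₁ := ((Finset.univ : Finset (Subgroup G)).filter fun H : Subgroup G => ρ ∉ H ∧ H.index = 2 ∧
        (T.filter fun s => s ∈ H).card = (T.filter fun s => s ∉ H).card) with hB₁
  set B₂ := ((Finset.univ : Finset (Subgroup G)).filter fun H : Subgroup G => ρ ∉ H ∧ H.index = 4 ∧ IsCyclic (G ⧸ H) ∧
        ∀ g : G, 2 * ((T.filter fun s => g⁻¹ * s ∈ H).card) = Nat.card H) with hB₂
  set B₃ := ((Finset.univ : Finset (Subgroup G)).filter fun H : Subgroup G => ρ ∉ H ∧ H.index = 2 * p ∧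
        ∀ x : G, x ^ p ∈ H → ∀ g : G,
          (T.filter fun s => (g * x)⁻¹ * s ∈ H).card = (T.filter fun s => g⁻¹ * s ∈ H).card) with hB₃
  set B₄ := ((Finset.univ : Finset (Subgroup G)).filter fun H : Subgroup G => ρ ∉ H ∧ H.index = 4 * p ∧ IsCyclic (G ⧸ H) ∧
        ∀ x : G, x ^ p ∈ H → ∀ g : G,
          (T.filter fun s => (g * x)⁻¹ * s ∈ H).card = (T.filter fun s => g⁻¹ * s ∈ H).card) with hB₄
  set B₅ := ((Finset.univ : Finset (Subgroup G)).filter fun H : Subgroup G => ρ ∉ H ∧ H.index = 2 * p ^ 2 ∧ IsCyclic (G ⧸ H) ∧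
        ∀ x : G, x ^ p ∈ H → ∀ g : G,
          (T.filter fun s => (g * x)⁻¹ * s ∈ H).card = (T.filter fun s => g⁻¹ * s ∈ H).card) with hB₅
  set B₆ := ((Finset.univ : Finset (Subgroup G)).filter fun H : Subgroup G => ρ ∉ H ∧ H.index = 4 * p ^ 2 ∧ IsCyclic (G ⧸ H) ∧
        ∀ x : G, x ^ p ∈ H → ∀ g : G,
          (T.filter fun s => (g * x)⁻¹ * s ∈ H).card = (T.filter fun s => g⁻¹ * s ∈ H).card) with hB₆
  -- index `2`
  have hA₁ : A.filter (fun H => H.index = 2) = B₁ := by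
    rw [hA, hB₁, Finset.filter_filter]
    refine Finset.filter_congr fun H _ => ?_
    constructor
    · rintro ⟨⟨hρH, -, hchar⟩, hidx⟩
      exact ⟨hρH, hidx,
        (CyclicCMType.AbelianKernels.forall_sum_char_eq_zero_iff_of_index_two hρ2 hρH hidx T).1 hchar⟩
    · rintro ⟨hρH, hidx, hsplit⟩
      haveI : Fact (Nat.Prime 2) := ⟨Nat.prime_two⟩
      exact ⟨⟨hρH, isCyclic_of_prime_card (p := 2) (by rw [← Subgroup.index_eq_card, hidx]),
        (CyclicCMType.AbelianKernels.forall_sum_char_eq_zero_iff_of_index_two hρ2 hρH hidx T).2 hsplit⟩, hidx⟩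
  -- index `4`
  have hA₂ : A.filter (fun H => H.index = 4) = B₂ := by
    rw [hA, hB₂, Finset.filter_filter]
    refine Finset.filter_congr fun H _ => ?_
    constructor
    · rintro ⟨⟨hρH, hcyc, hchar⟩, hidx⟩
      exact ⟨hρH, hidx, hcyc,
        (CyclicCMType.AbelianKernels.forall_sum_char_eq_zero_iff_of_index_four h hρH hidx hcyc).1 hchar⟩
    · rintro ⟨hρH, hidx, hcyc, hhalf⟩
      exact ⟨⟨hρH, hcyc,
        (CyclicCMType.AbelianKernels.forall_sum_char_eq_zero_iff_of_index_four h hρH hidx hcyc).2 hhalf⟩, hidx⟩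
  -- index `2p`
  have hA₃ : A.filter (fun H => H.index = 2 * p) = B₃ := by
    rw [hA, hB₃, Finset.filter_filter]
    refine Finset.filter_congr fun H _ => ?_
    constructor
    · rintro ⟨⟨hρH, hcyc, hchar⟩, hidx⟩
      have hidx'' : H.index = 2 * p ^ (0 + 1) := by rw [zero_add, pow_one]; exact hidx
      exact ⟨hρH, hidx, (CyclicCMType.AbelianKernels.forall_sum_char_eq_zero_iff_equidistributed_of_index
        hp2 h hρH hcyc hidx'').1 hchar⟩
    · rintro ⟨hρH, hidx, hE⟩
      have hcyc : IsCyclic (G ⧸ H) :=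
        isCyclic_of_card_eq_two_mul₄ₚ₂ hp2 (by rw [← Subgroup.index_eq_card, hidx])
      have hidx'' : H.index = 2 * p ^ (0 + 1) := by rw [zero_add, pow_one]; exact hidx
      exact ⟨⟨hρH, hcyc, (CyclicCMType.AbelianKernels.forall_sum_char_eq_zero_iff_equidistributed_of_index
        hp2 h hρH hcyc hidx'').2 hE⟩, hidx⟩
  -- index `4p`
  have hA₄ : A.filter (fun H => H.index = 4 * p) = B₄ := by
    rw [hA, hB₄, Finset.filter_filter]
    refine Finset.filter_congr fun H _ => ?_
    constructor
    · rintro ⟨⟨hρH, hcyc, hchar⟩, hidx⟩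
      exact ⟨hρH, hidx, hcyc, (CyclicCMType.AbelianKernels.forall_sum_char_eq_zero_iff_equidistributed_of_index_four_mul
        hp2 h hρH hcyc hidx).1 hchar⟩
    · rintro ⟨hρH, hidx, hcyc, hE⟩
      exact ⟨⟨hρH, hcyc, (CyclicCMType.AbelianKernels.forall_sum_char_eq_zero_iff_equidistributed_of_index_four_mul
        hp2 h hρH hcyc hidx).2 hE⟩, hidx⟩
  -- index `2p²`
  have hA₅ : A.filter (fun H => H.index = 2 * p ^ 2) = B₅ := by
    rw [hA, hB₅, Finset.filter_filter]
    refine Finset.filter_congr fun H _ => ?_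
    constructor
    · rintro ⟨⟨hρH, hcyc, hchar⟩, hidx⟩
      have hidx'' : H.index = 2 * p ^ (1 + 1) := by simpa using hidx
      exact ⟨hρH, hidx, hcyc, (CyclicCMType.AbelianKernels.forall_sum_char_eq_zero_iff_equidistributed_of_index
        hp2 h hρH hcyc hidx'').1 hchar⟩
    · rintro ⟨hρH, hidx, hcyc, hE⟩
      have hidx'' : H.index = 2 * p ^ (1 + 1) := by simpa using hidx
      exact ⟨⟨hρH, hcyc, (CyclicCMType.AbelianKernels.forall_sum_char_eq_zero_iff_equidistributed_of_index
        hp2 h hρH hcyc hidx'').2 hE⟩, hidx⟩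
  -- index `4p²`
  have hA₆ : A.filter (fun H => H.index = 4 * p ^ 2) = B₆ := by
    rw [hA, hB₆, Finset.filter_filter]
    refine Finset.filter_congr fun H _ => ?_
    constructor
    · rintro ⟨⟨hρH, hcyc, hchar⟩, hidx⟩
      have hidx'' : H.index = 4 * p ^ (1 + 1) := by simpa using hidx
      exact ⟨hρH, hidx, hcyc, (CyclicCMType.AbelianKernels.forall_sum_char_eq_zero_iff_equidistributed_of_index_four_mul_primePow
        hp2 h hρH hcyc hidx'').1 hchar⟩
    · rintro ⟨hρH, hidx, hcyc, hE⟩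
      have hidx'' : H.index = 4 * p ^ (1 + 1) := by simpa using hidx
      exact ⟨⟨hρH, hcyc, (CyclicCMType.AbelianKernels.forall_sum_char_eq_zero_iff_equidistributed_of_index_four_mul_primePow
        hp2 h hρH hcyc hidx'').2 hE⟩, hidx⟩
  -- Euler's `φ` on the admissible kernels, pointwise
  have hpt : ∀ H ∈ A, H.index.totient =
      (if H.index = 2 then 1 else 0) + 2 * (if H.index = 4 then 1 else 0) +
        (p - 1) * (if H.index = 2 * p then 1 else 0) + 2 * (p - 1) * (if H.index = 4 * p then 1 else 0) +
        p * (p - 1) * (if H.index = 2 * p ^ 2 then 1 else 0) + 2 * (p * (p - 1)) * (if H.index = 4 * p ^ 2 then 1 else 0) := by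
    intro H hH
    rw [hA, Finset.mem_filter] at hH
    obtain ⟨-, hρH, hcyc, -⟩ := hH
    have ht4 : Nat.totient 4 = 2 := by decide
    rcases index_eq_of_isCyclic_quotient hp2 hexp hρH hρ2 hcyc with hi | hi | hi | hi | hi | hi <;> rw [hi]
    · rw [if_pos rfl, if_neg (by omega : (2 : ℕ) ≠ 4), if_neg (by omega : (2 : ℕ) ≠ 2 * p),
        if_neg (by omega : (2 : ℕ) ≠ 4 * p), if_neg (by omega : (2 : ℕ) ≠ 2 * p ^ 2), if_neg (by omega : (2 : ℕ) ≠ 4 * p ^ 2),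
        Nat.totient_two]
      simp
    · rw [if_neg (by omega : (4 : ℕ) ≠ 2), if_pos rfl, if_neg (by omega : (4 : ℕ) ≠ 2 * p),
        if_neg (by omega : (4 : ℕ) ≠ 4 * p), if_neg (by omega : (4 : ℕ) ≠ 2 * p ^ 2), if_neg (by omega : (4 : ℕ) ≠ 4 * p ^ 2),
        ht4]
      simp
    · rw [if_neg (by omega : 2 * p ≠ 2), if_neg (by omega : 2 * p ≠ 4), if_pos rfl,
        if_neg (by omega : 2 * p ≠ 4 * p), if_neg (by omega : 2 * p ≠ 2 * p ^ 2), if_neg (by omega : 2 * p ≠ 4 * p ^ 2),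
        Nat.totient_mul h2p, Nat.totient_two, Nat.totient_prime hp.out]
      simp
    · rw [if_neg (by omega : 4 * p ≠ 2), if_neg (by omega : 4 * p ≠ 4), if_neg (by omega : 4 * p ≠ 2 * p),
        if_pos rfl, if_neg (by omega : 4 * p ≠ 2 * p ^ 2), if_neg (by omega : 4 * p ≠ 4 * p ^ 2),
        Nat.totient_mul h4p, ht4, Nat.totient_prime hp.out]
      simp
    · rw [if_neg (by omega : 2 * p ^ 2 ≠ 2), if_neg (by omega : 2 * p ^ 2 ≠ 4), if_neg (by omega : 2 * p ^ 2 ≠ 2 * p),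
        if_neg (by omega : 2 * p ^ 2 ≠ 4 * p), if_pos rfl, if_neg (by omega : 2 * p ^ 2 ≠ 4 * p ^ 2),
        Nat.totient_mul h2p2, Nat.totient_two, Nat.totient_prime_pow hp.out two_pos]
      simp
    · rw [if_neg (by omega : 4 * p ^ 2 ≠ 2), if_neg (by omega : 4 * p ^ 2 ≠ 4), if_neg (by omega : 4 * p ^ 2 ≠ 2 * p),
        if_neg (by omega : 4 * p ^ 2 ≠ 4 * p), if_neg (by omega : 4 * p ^ 2 ≠ 2 * p ^ 2), if_pos rfl,
        Nat.totient_mul h4p2, ht4, Nat.totient_prime_pow hp.out two_pos]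
      simp
  have hsum : ∑ H ∈ A, H.index.totient = B₁.card + 2 * B₂.card + (p - 1) * B₃.card + 2 * (p - 1) * B₄.card +
      p * (p - 1) * B₅.card + 2 * (p * (p - 1)) * B₆.card := by
    rw [Finset.sum_congr rfl hpt, Finset.sum_add_distrib, Finset.sum_add_distrib, Finset.sum_add_distrib, Finset.sum_add_distrib,
      Finset.sum_add_distrib, ← Finset.mul_sum, ← Finset.mul_sum, ← Finset.mul_sum, ← Finset.mul_sum, ← Finset.mul_sum,
      ← Finset.card_filter, ← Finset.card_filter, ← Finset.card_filter, ← Finset.card_filter, ← Finset.card_filter,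
      ← Finset.card_filter, hA₁, hA₂, hA₃, hA₄, hA₅, hA₆]
  have e : typeRank G (T : Set G) + B₁.card + 2 * B₂.card + (p - 1) * B₃.card + 2 * (p - 1) * B₄.card +
      p * (p - 1) * B₅.card + 2 * (p * (p - 1)) * B₆.card = typeRank G (T : Set G) + ∑ H ∈ A, H.index.totient := by
    rw [hsum]; ring
  rw [e]
  exact key

/-- **NONDEGENERATE iff all six families are empty** (exponent `4p²`). [cite: Kubota1965, §4 Lemma 2] [cite: Hazama2003CyclicCM, Prop. 4.3]
[cite: Dodson1984, §3.1.1 Theorem] [cite: Dodson1987, Prop. 4.4] [cite: Gordon1999HodgeAVSurvey, 9.4.3] -/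
theorem typeRank_eq_iff [hp : Fact p.Prime] (hp2 : p ≠ 2) {ρ : G} {T : Finset G}
    (h : IsCMTypeWith ρ (T : Set G)) (hexp : ∀ g : G, g ^ (4 * p ^ 2) = 1) :
    typeRank G (T : Set G) = Fintype.card G / 2 + 1 ↔
      (∀ H : Subgroup G, ρ ∉ H → H.index = 2 →
          (T.filter fun s => s ∈ H).card ≠ (T.filter fun s => s ∉ H).card) ∧
      (∀ H : Subgroup G, ρ ∉ H → H.index = 4 → IsCyclic (G ⧸ H) →
          ¬ ∀ g : G, 2 * ((T.filter fun s => g⁻¹ * s ∈ H).card) = Nat.card H) ∧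
      (∀ H : Subgroup G, ρ ∉ H → H.index = 2 * p →
          ¬ ∀ x : G, x ^ p ∈ H → ∀ g : G,
            (T.filter fun s => (g * x)⁻¹ * s ∈ H).card = (T.filter fun s => g⁻¹ * s ∈ H).card) ∧
      (∀ H : Subgroup G, ρ ∉ H → H.index = 4 * p → IsCyclic (G ⧸ H) →
          ¬ ∀ x : G, x ^ p ∈ H → ∀ g : G,
            (T.filter fun s => (g * x)⁻¹ * s ∈ H).card = (T.filter fun s => g⁻¹ * s ∈ H).card) ∧
      (∀ H : Subgroup G, ρ ∉ H → H.index = 2 * p ^ 2 → IsCyclic (G ⧸ H) →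
          ¬ ∀ x : G, x ^ p ∈ H → ∀ g : G,
            (T.filter fun s => (g * x)⁻¹ * s ∈ H).card = (T.filter fun s => g⁻¹ * s ∈ H).card) ∧
      (∀ H : Subgroup G, ρ ∉ H → H.index = 4 * p ^ 2 → IsCyclic (G ⧸ H) →
          ¬ ∀ x : G, x ^ p ∈ H → ∀ g : G,
            (T.filter fun s => (g * x)⁻¹ * s ∈ H).card = (T.filter fun s => g⁻¹ * s ∈ H).card) := by
  have hp1 : p - 1 ≠ 0 := by have := hp.out.two_le; omega
  have hpp1 : p * (p - 1) ≠ 0 := mul_ne_zero hp.out.ne_zero hp1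
  rw [eq_iff_of_add_eq₄ₚ₂ hp1 hpp1 (typeRank_add_card_kernels_eq hp2 h hexp), Finset.card_eq_zero, Finset.card_eq_zero,
    Finset.card_eq_zero, Finset.card_eq_zero, Finset.card_eq_zero, Finset.card_eq_zero, Finset.filter_eq_empty_iff,
    Finset.filter_eq_empty_iff, Finset.filter_eq_empty_iff, Finset.filter_eq_empty_iff, Finset.filter_eq_empty_iff,
    Finset.filter_eq_empty_iff]
  simp only [Finset.mem_univ, forall_true_left, not_and, ne_eq]

end Group

/-! ## §2 Abelian CM fields with Galois group of exponent `4p²`: the defect on the lattice of subfields -/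

section Field

variable {K : Type} [Field K] [NumberField K] [IsCMField K] [IsAbelianGalois ℚ K] {p : ℕ}

/-- **The defect on `Gal(K/ℚ)` for an abelian CM field of exponent `4p²`** (six families of `typeRank_add_card_kernels_eq` read on the
subgroups of `Gal(K/ℚ)`; `S = {g : σ_g ∈ Φ}`). [cite: Kubota1965, §4 Lemma 2] [cite: Hazama2003CyclicCM, Prop. 4.3] [cite: Dodson1984, §3.1.1 Theorem]
[cite: Dodson1987, Prop. 4.4] [cite: Gordon1999HodgeAVSurvey, 9.4.3] -/
theorem cmTypeRank_add_card_kernels_eq [Fact p.Prime] (hp2 : p ≠ 2) (φ₀ : K →+* ℂ)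
    (hexp : ∀ g : K ≃ₐ[ℚ] K, g ^ (4 * p ^ 2) = 1) (Φ : CMType K) :
    cmTypeRank Φ +
      ((Finset.univ : Finset (Subgroup (K ≃ₐ[ℚ] K))).filter fun H : Subgroup (K ≃ₐ[ℚ] K) =>
        (conjGal : K ≃ₐ[ℚ] K) ∉ H ∧ H.index = 2 ∧
        ((Finset.univ.filter fun g : K ≃ₐ[ℚ] K => embOf φ₀ g ∈ Φ.1).filter fun s => s ∈ H).card =
          ((Finset.univ.filter fun g : K ≃ₐ[ℚ] K => embOf φ₀ g ∈ Φ.1).filter fun s => s ∉ H).card).card +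
      2 * ((Finset.univ : Finset (Subgroup (K ≃ₐ[ℚ] K))).filter fun H : Subgroup (K ≃ₐ[ℚ] K) =>
        (conjGal : K ≃ₐ[ℚ] K) ∉ H ∧ H.index = 4 ∧ IsCyclic ((K ≃ₐ[ℚ] K) ⧸ H) ∧
        ∀ g : K ≃ₐ[ℚ] K, 2 * (((Finset.univ.filter fun g : K ≃ₐ[ℚ] K => embOf φ₀ g ∈ Φ.1).filter
          fun s => g⁻¹ * s ∈ H).card) = Nat.card H).card +
      (p - 1) * ((Finset.univ : Finset (Subgroup (K ≃ₐ[ℚ] K))).filter fun H : Subgroup (K ≃ₐ[ℚ] K) =>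
        (conjGal : K ≃ₐ[ℚ] K) ∉ H ∧ H.index = 2 * p ∧
        ∀ x : K ≃ₐ[ℚ] K, x ^ p ∈ H → ∀ g : K ≃ₐ[ℚ] K,
          ((Finset.univ.filter fun g : K ≃ₐ[ℚ] K => embOf φ₀ g ∈ Φ.1).filter fun s => (g * x)⁻¹ * s ∈ H).card =
          ((Finset.univ.filter fun g : K ≃ₐ[ℚ] K => embOf φ₀ g ∈ Φ.1).filter fun s => g⁻¹ * s ∈ H).card).card +
      2 * (p - 1) * ((Finset.univ : Finset (Subgroup (K ≃ₐ[ℚ] K))).filter fun H : Subgroup (K ≃ₐ[ℚ] K) =>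
        (conjGal : K ≃ₐ[ℚ] K) ∉ H ∧ H.index = 4 * p ∧ IsCyclic ((K ≃ₐ[ℚ] K) ⧸ H) ∧
        ∀ x : K ≃ₐ[ℚ] K, x ^ p ∈ H → ∀ g : K ≃ₐ[ℚ] K,
          ((Finset.univ.filter fun g : K ≃ₐ[ℚ] K => embOf φ₀ g ∈ Φ.1).filter fun s => (g * x)⁻¹ * s ∈ H).card =
          ((Finset.univ.filter fun g : K ≃ₐ[ℚ] K => embOf φ₀ g ∈ Φ.1).filter fun s => g⁻¹ * s ∈ H).card).card +
      p * (p - 1) * ((Finset.univ : Finset (Subgroup (K ≃ₐ[ℚ] K))).filter fun H : Subgroup (K ≃ₐ[ℚ] K) =>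
        (conjGal : K ≃ₐ[ℚ] K) ∉ H ∧ H.index = 2 * p ^ 2 ∧ IsCyclic ((K ≃ₐ[ℚ] K) ⧸ H) ∧
        ∀ x : K ≃ₐ[ℚ] K, x ^ p ∈ H → ∀ g : K ≃ₐ[ℚ] K,
          ((Finset.univ.filter fun g : K ≃ₐ[ℚ] K => embOf φ₀ g ∈ Φ.1).filter fun s => (g * x)⁻¹ * s ∈ H).card =
          ((Finset.univ.filter fun g : K ≃ₐ[ℚ] K => embOf φ₀ g ∈ Φ.1).filter fun s => g⁻¹ * s ∈ H).card).card +
      2 * (p * (p - 1)) * ((Finset.univ : Finset (Subgroup (K ≃ₐ[ℚ] K))).filter fun H : Subgroup (K ≃ₐ[ℚ] K) =>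
        (conjGal : K ≃ₐ[ℚ] K) ∉ H ∧ H.index = 4 * p ^ 2 ∧ IsCyclic ((K ≃ₐ[ℚ] K) ⧸ H) ∧
        ∀ x : K ≃ₐ[ℚ] K, x ^ p ∈ H → ∀ g : K ≃ₐ[ℚ] K,
          ((Finset.univ.filter fun g : K ≃ₐ[ℚ] K => embOf φ₀ g ∈ Φ.1).filter fun s => (g * x)⁻¹ * s ∈ H).card =
          ((Finset.univ.filter fun g : K ≃ₐ[ℚ] K => embOf φ₀ g ∈ Φ.1).filter fun s => g⁻¹ * s ∈ H).card).card =
      Module.finrank ℚ K / 2 + 1 := by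
  rw [cmTypeRank_eq_typeRank_galType Φ φ₀, ← card_gal_eq_finrank φ₀]
  exact typeRank_add_card_kernels_eq hp2 (isCMTypeWith_galType (AbelianCMFieldExistence.apply_conjGal_eq φ₀) Φ) hexp

/-- **THE RANK OF A CM TYPE OF AN ABELIAN CM FIELD OF EXPONENT `4p²`, ON THE LATTICE OF SUBFIELDS.**  Let `K` be a CM field, abelian over
`ℚ`, with `g^{4p²} = 1` on `Gal(K/ℚ)` (`p` an odd prime — e.g. `ℚ(ζ₃₇) = ℚ(ζ₇₄)` with `Gal ≅ ℤ/36`, `ℚ(ζ_{111})`, `ℚ(ζ_{148})`, composita of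
`ℚ(ζ₃₇)` with `ℚ(ζ₅), ℚ(ζ₁₅), ℚ(ζ₁₆), ℚ(ζ₂₀)`, their CM subfields), and `Φ` ANY CM type of `K`.  Then

  `Rank(Φ) + b + 2·e₄ + (p − 1)·e_{2p} + 2(p − 1)·e_{4p} + p(p − 1)·e_{2p²} + 2p(p − 1)·e_{4p²} = [K:ℚ]/2 + 1`,

`b` = #imaginary quadratic subfields over which `Φ` is balanced (Weil type); `e₄` = #CM subfields `F` with `Gal(F/ℚ) ≅ ℤ/4` every embedding of
which has `[K:F]/2` extensions in `Φ`; `e_{2p}` = #CM subfields of degree `2p` over which `Φ` is LEVEL of exponent `p`; `e_{4p}, e_{2p²}, e_{4p²}` =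
#CM subfields of degree `4p, 2p², 4p²` with CYCLIC Galois group over which `Φ` is level of exponent `p` (for every `σ ∈ Gal(F/ℚ)` with `σ^p = 1`
and every `τ : F → ℂ`, `#{φ ∈ Φ : φ|_F = τ ∘ σ} = #{φ ∈ Φ : φ|_F = τ}`). [cite: Kubota1965, §4 Lemma 2] [cite: Hazama2003CyclicCM, Prop. 4.3 and Lemma 4.6.1]
[cite: Dodson1984, §3.1.1 Theorem] [cite: Dodson1987, Prop. 4.4] [cite: Gordon1999HodgeAVSurvey, 5.13 (ii), 9.4.1 and 9.4.3]
[cite: Yanai2015IndexDegeneracy, Thm. 4.1 (proof, p. 818)] -/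
theorem cmTypeRank_add_ncard_subfields_eq [Fact p.Prime] (hp2 : p ≠ 2)
    (hexp : ∀ g : K ≃ₐ[ℚ] K, g ^ (4 * p ^ 2) = 1) (Φ : CMType K) :
    cmTypeRank Φ + {F : IntermediateField ℚ K | Module.finrank ℚ F = 2 ∧ ¬ IsTotallyReal F ∧
        ∀ τ : F →+* ℂ, {φ : K →+* ℂ | φ.comp (algebraMap F K) = τ ∧ φ ∈ Φ.1}.ncard =
          {φ : K →+* ℂ | φ.comp (algebraMap F K) = τ ∧ φ ∉ Φ.1}.ncard}.ncard +
      2 * {F : IntermediateField ℚ K | Module.finrank ℚ F = 4 ∧ ¬ IsTotallyReal F ∧ IsCyclic (F ≃ₐ[ℚ] F) ∧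
        ∀ τ : F →+* ℂ, 2 * {φ : K →+* ℂ | φ.comp (algebraMap F K) = τ ∧ φ ∈ Φ.1}.ncard = Module.finrank F K}.ncard +
      (p - 1) * {F : IntermediateField ℚ K | Module.finrank ℚ F = 2 * p ∧ ¬ IsTotallyReal F ∧
        ∀ σ : F ≃ₐ[ℚ] F, σ ^ p = 1 → ∀ τ : F →+* ℂ,
          {φ : K →+* ℂ | φ.comp (algebraMap F K) = τ.comp σ.toRingEquiv.toRingHom ∧ φ ∈ Φ.1}.ncard =
            {φ : K →+* ℂ | φ.comp (algebraMap F K) = τ ∧ φ ∈ Φ.1}.ncard}.ncard +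
      2 * (p - 1) * {F : IntermediateField ℚ K | Module.finrank ℚ F = 4 * p ∧ ¬ IsTotallyReal F ∧ IsCyclic (F ≃ₐ[ℚ] F) ∧
        ∀ σ : F ≃ₐ[ℚ] F, σ ^ p = 1 → ∀ τ : F →+* ℂ,
          {φ : K →+* ℂ | φ.comp (algebraMap F K) = τ.comp σ.toRingEquiv.toRingHom ∧ φ ∈ Φ.1}.ncard =
            {φ : K →+* ℂ | φ.comp (algebraMap F K) = τ ∧ φ ∈ Φ.1}.ncard}.ncard +
      p * (p - 1) * {F : IntermediateField ℚ K | Module.finrank ℚ F = 2 * p ^ 2 ∧ ¬ IsTotallyReal F ∧ IsCyclic (F ≃ₐ[ℚ] F) ∧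
        ∀ σ : F ≃ₐ[ℚ] F, σ ^ p = 1 → ∀ τ : F →+* ℂ,
          {φ : K →+* ℂ | φ.comp (algebraMap F K) = τ.comp σ.toRingEquiv.toRingHom ∧ φ ∈ Φ.1}.ncard =
            {φ : K →+* ℂ | φ.comp (algebraMap F K) = τ ∧ φ ∈ Φ.1}.ncard}.ncard +
      2 * (p * (p - 1)) * {F : IntermediateField ℚ K | Module.finrank ℚ F = 4 * p ^ 2 ∧ ¬ IsTotallyReal F ∧ IsCyclic (F ≃ₐ[ℚ] F) ∧
        ∀ σ : F ≃ₐ[ℚ] F, σ ^ p = 1 → ∀ τ : F →+* ℂ,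
          {φ : K →+* ℂ | φ.comp (algebraMap F K) = τ.comp σ.toRingEquiv.toRingHom ∧ φ ∈ Φ.1}.ncard =
            {φ : K →+* ℂ | φ.comp (algebraMap F K) = τ ∧ φ ∈ Φ.1}.ncard}.ncard = Module.finrank ℚ K / 2 + 1 := by
  obtain ⟨φ₀⟩ := (inferInstance : Nonempty (K →+* ℂ))
  rw [← card_indexTwo_eq_ncard_weilQuadratic φ₀ Φ, ← card_indexFour_eq_ncard_weilQuartic φ₀ Φ,
    ← card_index_eq_ncard_level φ₀ Φ, ← card_index_isCyclic_eq_ncard_level φ₀ Φ (4 * p),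
    ← card_index_isCyclic_eq_ncard_level φ₀ Φ (2 * p ^ 2), ← card_index_isCyclic_eq_ncard_level φ₀ Φ (4 * p ^ 2)]
  exact cmTypeRank_add_card_kernels_eq hp2 φ₀ hexp Φ

omit [IsCMField K] [IsAbelianGalois ℚ K] in
/-- A number field has finitely many subfields (primitive element theorem). [folklore] -/
private theorem finite_intermediateField₄ₚ₂ : Finite (IntermediateField ℚ K) :=
  Field.finite_intermediateField_of_exists_primitive_element ℚ K (Field.exists_primitive_element ℚ K)

/-- **NONDEGENERACY CRITERION ON THE LATTICE OF SUBFIELDS (exponent `4p²`)**: `Φ` is nondegenerate iff it is balanced over no imaginary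
quadratic subfield, halves no cyclic quartic CM subfield, and is level of exponent `p` over no CM subfield of degree `2p` and over no CM
subfield of degree `4p, 2p², 4p²` with cyclic Galois group. [cite: Kubota1965, §4 Lemma 2] [cite: Hazama2003CyclicCM, Prop. 4.3]
[cite: Dodson1984, §3.1.1 Theorem] [cite: Dodson1987, Prop. 4.4] [cite: Gordon1999HodgeAVSurvey, 9.4.3] -/
theorem isNondegenerate_iff_forall_intermediateField [hp : Fact p.Prime] (hp2 : p ≠ 2)
    (hexp : ∀ g : K ≃ₐ[ℚ] K, g ^ (4 * p ^ 2) = 1) (Φ : CMType K) :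
    IsNondegenerate Φ ↔
      (∀ F : IntermediateField ℚ K, Module.finrank ℚ F = 2 → ¬ IsTotallyReal F →
        ¬ ∀ τ : F →+* ℂ, {φ : K →+* ℂ | φ.comp (algebraMap F K) = τ ∧ φ ∈ Φ.1}.ncard =
          {φ : K →+* ℂ | φ.comp (algebraMap F K) = τ ∧ φ ∉ Φ.1}.ncard) ∧
      (∀ F : IntermediateField ℚ K, Module.finrank ℚ F = 4 → ¬ IsTotallyReal F → IsCyclic (F ≃ₐ[ℚ] F) →
        ¬ ∀ τ : F →+* ℂ, 2 * {φ : K →+* ℂ | φ.comp (algebraMap F K) = τ ∧ φ ∈ Φ.1}.ncard = Module.finrank F K) ∧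
      (∀ F : IntermediateField ℚ K, Module.finrank ℚ F = 2 * p → ¬ IsTotallyReal F →
        ¬ ∀ σ : F ≃ₐ[ℚ] F, σ ^ p = 1 → ∀ τ : F →+* ℂ,
          {φ : K →+* ℂ | φ.comp (algebraMap F K) = τ.comp σ.toRingEquiv.toRingHom ∧ φ ∈ Φ.1}.ncard =
            {φ : K →+* ℂ | φ.comp (algebraMap F K) = τ ∧ φ ∈ Φ.1}.ncard) ∧
      (∀ F : IntermediateField ℚ K, Module.finrank ℚ F = 4 * p → ¬ IsTotallyReal F → IsCyclic (F ≃ₐ[ℚ] F) →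
        ¬ ∀ σ : F ≃ₐ[ℚ] F, σ ^ p = 1 → ∀ τ : F →+* ℂ,
          {φ : K →+* ℂ | φ.comp (algebraMap F K) = τ.comp σ.toRingEquiv.toRingHom ∧ φ ∈ Φ.1}.ncard =
            {φ : K →+* ℂ | φ.comp (algebraMap F K) = τ ∧ φ ∈ Φ.1}.ncard) ∧
      (∀ F : IntermediateField ℚ K, Module.finrank ℚ F = 2 * p ^ 2 → ¬ IsTotallyReal F → IsCyclic (F ≃ₐ[ℚ] F) →
        ¬ ∀ σ : F ≃ₐ[ℚ] F, σ ^ p = 1 → ∀ τ : F →+* ℂ,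
          {φ : K →+* ℂ | φ.comp (algebraMap F K) = τ.comp σ.toRingEquiv.toRingHom ∧ φ ∈ Φ.1}.ncard =
            {φ : K →+* ℂ | φ.comp (algebraMap F K) = τ ∧ φ ∈ Φ.1}.ncard) ∧
      (∀ F : IntermediateField ℚ K, Module.finrank ℚ F = 4 * p ^ 2 → ¬ IsTotallyReal F → IsCyclic (F ≃ₐ[ℚ] F) →
        ¬ ∀ σ : F ≃ₐ[ℚ] F, σ ^ p = 1 → ∀ τ : F →+* ℂ,
          {φ : K →+* ℂ | φ.comp (algebraMap F K) = τ.comp σ.toRingEquiv.toRingHom ∧ φ ∈ Φ.1}.ncard =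
            {φ : K →+* ℂ | φ.comp (algebraMap F K) = τ ∧ φ ∈ Φ.1}.ncard) := by
  haveI := finite_intermediateField₄ₚ₂ (K := K)
  have hp1 : p - 1 ≠ 0 := by have := hp.out.two_le; omega
  have hpp1 : p * (p - 1) ≠ 0 := mul_ne_zero hp.out.ne_zero hp1
  rw [_root_.Literature.AlgebraicGeometry.Pohlmann1968.isNondegenerate_iff,
    eq_iff_of_add_eq₄ₚ₂ hp1 hpp1 (cmTypeRank_add_ncard_subfields_eq hp2 hexp Φ),
    Set.ncard_eq_zero, Set.ncard_eq_zero, Set.ncard_eq_zero, Set.ncard_eq_zero, Set.ncard_eq_zero, Set.ncard_eq_zero,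
    Set.eq_empty_iff_forall_notMem, Set.eq_empty_iff_forall_notMem, Set.eq_empty_iff_forall_notMem,
    Set.eq_empty_iff_forall_notMem, Set.eq_empty_iff_forall_notMem, Set.eq_empty_iff_forall_notMem]
  simp only [Set.mem_setOf_eq, not_and]

/-- **Conversely: a CM subfield of degree `4p²` with cyclic Galois group over which `Φ` is level makes the type DEGENERATE** (it costs
`φ(4p²) = 2p(p − 1)` in rank). [cite: Kubota1965, §4 Lemma 2] [cite: Hazama2003CyclicCM, Prop. 4.3 and Lemma 4.6.1] -/
theorem not_isNondegenerate_of_level_of_isCyclic [Fact p.Prime] (hp2 : p ≠ 2)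
    (hexp : ∀ g : K ≃ₐ[ℚ] K, g ^ (4 * p ^ 2) = 1) (Φ : CMType K) (F : IntermediateField ℚ K)
    (h4p2 : Module.finrank ℚ F = 4 * p ^ 2) (hF : ¬ IsTotallyReal F) (hcyc : IsCyclic (F ≃ₐ[ℚ] F))
    (hlev : ∀ σ : F ≃ₐ[ℚ] F, σ ^ p = 1 → ∀ τ : F →+* ℂ,
      {φ : K →+* ℂ | φ.comp (algebraMap F K) = τ.comp σ.toRingEquiv.toRingHom ∧ φ ∈ Φ.1}.ncard =
        {φ : K →+* ℂ | φ.comp (algebraMap F K) = τ ∧ φ ∈ Φ.1}.ncard) : ¬ IsNondegenerate Φ := by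
  rw [isNondegenerate_iff_forall_intermediateField hp2 hexp Φ]
  exact fun h => h.2.2.2.2.2 F h4p2 hF hcyc hlev

end Field

/-! ## §3 Consequences for abelian varieties: `B•(Aⁿ) ⊗ ℂ = D•(Aⁿ) ⊗ ℂ` and the Hodge conjecture for all powers -/

section Varieties

open Literature.AlgebraicGeometry.Motives (AbelianVariety)
open Literature.AlgebraicGeometry.HodgeTheory
open Literature.AlgebraicGeometry.ComplexMultiplication (IsCMTypeRealisation)
open Literature.AlgebraicGeometry.VanGeemen1994 (hodgeClassSpan)
open Literature.Barriers.HodgeConjecture (divisorClassesSpan)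
open _root_.CategoryTheory _root_.CategoryTheory.Limits

variable {K : Type} [Field K] [NumberField K] [IsCMField K] [IsAbelianGalois ℚ K] {p : ℕ}
  {Φ : CMType K} {A : AbelianVariety ℂ} {ι : 𝓞 K →+* End A} {θ : K →+* Module.End ℂ (complexBetti A.X 1)}

/-- `Bᵐ ⊗ ℂ = Dᵐ ⊗ ℂ` for all `m` on an abelian variety gives the Hodge conjecture for it (Lefschetz `(1,1)`, cup products, tree
theorems). [cite: Gordon1999HodgeAVSurvey, §9.3] -/
private theorem hodgeConjectureFor_of_forall_hodgeClassSpan_eq₄ₚ₂ (B : AbelianVariety ℂ)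
    (h : ∀ m : ℕ, hodgeClassSpan B.dim B.X m = divisorClassesSpan B.X B.dim m) : HodgeConjectureFor B.dim B.X :=
  ⟨nonempty_hodgeModel_holds (Motives.AbelianVariety.isSmoothProjective_holds (A := B)),
    fun m _ hc hmm ↦ AbelianVariety.divisorClassesSpan_le_algebraicClasses B
      (fun b hb hb' ↦ lefschetzOneOne_rational_holds (Motives.AbelianVariety.isSmoothProjective_holds (A := B)) b hb hb') m
      ((h m) ▸ Submodule.subset_span ⟨hc, hmm⟩)⟩

/-- **`B•(Aⁿ) ⊗ ℂ = D•(Aⁿ) ⊗ ℂ` FOR EVERY REALISATION OF A TYPE SATISFYING THE SIX-CLAUSE CRITERION** (`K` abelian CM of exponent `4p²`).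
[cite: Kubota1965, §4 Lemma 2] [cite: Gordon1999HodgeAVSurvey, Thm. 6.4 and §9.3] [cite: Hazama2003CyclicCM, Prop. 4.3] -/
theorem hodgeClassSpan_pow_eq_divisorClassesSpan_of_forall_intermediateField [Fact p.Prime] (hp2 : p ≠ 2)
    (hexp : ∀ g : K ≃ₐ[ℚ] K, g ^ (4 * p ^ 2) = 1)
    (hW : ∀ F : IntermediateField ℚ K, Module.finrank ℚ F = 2 → ¬ IsTotallyReal F →
        ¬ ∀ τ : F →+* ℂ, {φ : K →+* ℂ | φ.comp (algebraMap F K) = τ ∧ φ ∈ Φ.1}.ncard =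
          {φ : K →+* ℂ | φ.comp (algebraMap F K) = τ ∧ φ ∉ Φ.1}.ncard)
    (hQ : ∀ F : IntermediateField ℚ K, Module.finrank ℚ F = 4 → ¬ IsTotallyReal F → IsCyclic (F ≃ₐ[ℚ] F) →
        ¬ ∀ τ : F →+* ℂ, 2 * {φ : K →+* ℂ | φ.comp (algebraMap F K) = τ ∧ φ ∈ Φ.1}.ncard = Module.finrank F K)
    (hL : ∀ F : IntermediateField ℚ K, Module.finrank ℚ F = 2 * p → ¬ IsTotallyReal F →
        ¬ ∀ σ : F ≃ₐ[ℚ] F, σ ^ p = 1 → ∀ τ : F →+* ℂ,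
          {φ : K →+* ℂ | φ.comp (algebraMap F K) = τ.comp σ.toRingEquiv.toRingHom ∧ φ ∈ Φ.1}.ncard =
            {φ : K →+* ℂ | φ.comp (algebraMap F K) = τ ∧ φ ∈ Φ.1}.ncard)
    (hM : ∀ F : IntermediateField ℚ K, Module.finrank ℚ F = 4 * p → ¬ IsTotallyReal F → IsCyclic (F ≃ₐ[ℚ] F) →
        ¬ ∀ σ : F ≃ₐ[ℚ] F, σ ^ p = 1 → ∀ τ : F →+* ℂ,
          {φ : K →+* ℂ | φ.comp (algebraMap F K) = τ.comp σ.toRingEquiv.toRingHom ∧ φ ∈ Φ.1}.ncard =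
            {φ : K →+* ℂ | φ.comp (algebraMap F K) = τ ∧ φ ∈ Φ.1}.ncard)
    (hL2 : ∀ F : IntermediateField ℚ K, Module.finrank ℚ F = 2 * p ^ 2 → ¬ IsTotallyReal F → IsCyclic (F ≃ₐ[ℚ] F) →
        ¬ ∀ σ : F ≃ₐ[ℚ] F, σ ^ p = 1 → ∀ τ : F →+* ℂ,
          {φ : K →+* ℂ | φ.comp (algebraMap F K) = τ.comp σ.toRingEquiv.toRingHom ∧ φ ∈ Φ.1}.ncard =
            {φ : K →+* ℂ | φ.comp (algebraMap F K) = τ ∧ φ ∈ Φ.1}.ncard)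
    (hM2 : ∀ F : IntermediateField ℚ K, Module.finrank ℚ F = 4 * p ^ 2 → ¬ IsTotallyReal F → IsCyclic (F ≃ₐ[ℚ] F) →
        ¬ ∀ σ : F ≃ₐ[ℚ] F, σ ^ p = 1 → ∀ τ : F →+* ℂ,
          {φ : K →+* ℂ | φ.comp (algebraMap F K) = τ.comp σ.toRingEquiv.toRingHom ∧ φ ∈ Φ.1}.ncard =
            {φ : K →+* ℂ | φ.comp (algebraMap F K) = τ ∧ φ ∈ Φ.1}.ncard)
    (hA : IsCMTypeRealisation Φ A ι θ) (n m : ℕ) :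
    hodgeClassSpan (⨁ fun _ : Fin n => A).dim (⨁ fun _ : Fin n => A).X m =
      divisorClassesSpan (⨁ fun _ : Fin n => A).X (⨁ fun _ : Fin n => A).dim m :=
  ((isNondegenerate_iff_forall_intermediateField hp2 hexp Φ).2 ⟨hW, hQ, hL, hM, hL2, hM2⟩).hodgeClassSpan_pow_eq_divisorClassesSpan
    hA n m

/-- **THE HODGE CONJECTURE FOR ALL POWERS OF EVERY REALISATION OF A TYPE SATISFYING THE SIX-CLAUSE CRITERION** (abelian CM field of
exponent `4p²`) — UNCONDITIONAL, any realisation. [cite: Gordon1999HodgeAVSurvey, Thm. 6.4 and §9.3] [cite: Kubota1965, §4 Lemma 2]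
[cite: Deligne2000, §1] -/
theorem hodgeConjectureFor_pow_of_forall_intermediateField [Fact p.Prime] (hp2 : p ≠ 2)
    (hexp : ∀ g : K ≃ₐ[ℚ] K, g ^ (4 * p ^ 2) = 1)
    (hW : ∀ F : IntermediateField ℚ K, Module.finrank ℚ F = 2 → ¬ IsTotallyReal F →
        ¬ ∀ τ : F →+* ℂ, {φ : K →+* ℂ | φ.comp (algebraMap F K) = τ ∧ φ ∈ Φ.1}.ncard =
          {φ : K →+* ℂ | φ.comp (algebraMap F K) = τ ∧ φ ∉ Φ.1}.ncard)
    (hQ : ∀ F : IntermediateField ℚ K, Module.finrank ℚ F = 4 → ¬ IsTotallyReal F → IsCyclic (F ≃ₐ[ℚ] F) →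
        ¬ ∀ τ : F →+* ℂ, 2 * {φ : K →+* ℂ | φ.comp (algebraMap F K) = τ ∧ φ ∈ Φ.1}.ncard = Module.finrank F K)
    (hL : ∀ F : IntermediateField ℚ K, Module.finrank ℚ F = 2 * p → ¬ IsTotallyReal F →
        ¬ ∀ σ : F ≃ₐ[ℚ] F, σ ^ p = 1 → ∀ τ : F →+* ℂ,
          {φ : K →+* ℂ | φ.comp (algebraMap F K) = τ.comp σ.toRingEquiv.toRingHom ∧ φ ∈ Φ.1}.ncard =
            {φ : K →+* ℂ | φ.comp (algebraMap F K) = τ ∧ φ ∈ Φ.1}.ncard)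
    (hM : ∀ F : IntermediateField ℚ K, Module.finrank ℚ F = 4 * p → ¬ IsTotallyReal F → IsCyclic (F ≃ₐ[ℚ] F) →
        ¬ ∀ σ : F ≃ₐ[ℚ] F, σ ^ p = 1 → ∀ τ : F →+* ℂ,
          {φ : K →+* ℂ | φ.comp (algebraMap F K) = τ.comp σ.toRingEquiv.toRingHom ∧ φ ∈ Φ.1}.ncard =
            {φ : K →+* ℂ | φ.comp (algebraMap F K) = τ ∧ φ ∈ Φ.1}.ncard)
    (hL2 : ∀ F : IntermediateField ℚ K, Module.finrank ℚ F = 2 * p ^ 2 → ¬ IsTotallyReal F → IsCyclic (F ≃ₐ[ℚ] F) →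
        ¬ ∀ σ : F ≃ₐ[ℚ] F, σ ^ p = 1 → ∀ τ : F →+* ℂ,
          {φ : K →+* ℂ | φ.comp (algebraMap F K) = τ.comp σ.toRingEquiv.toRingHom ∧ φ ∈ Φ.1}.ncard =
            {φ : K →+* ℂ | φ.comp (algebraMap F K) = τ ∧ φ ∈ Φ.1}.ncard)
    (hM2 : ∀ F : IntermediateField ℚ K, Module.finrank ℚ F = 4 * p ^ 2 → ¬ IsTotallyReal F → IsCyclic (F ≃ₐ[ℚ] F) →
        ¬ ∀ σ : F ≃ₐ[ℚ] F, σ ^ p = 1 → ∀ τ : F →+* ℂ,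
          {φ : K →+* ℂ | φ.comp (algebraMap F K) = τ.comp σ.toRingEquiv.toRingHom ∧ φ ∈ Φ.1}.ncard =
            {φ : K →+* ℂ | φ.comp (algebraMap F K) = τ ∧ φ ∈ Φ.1}.ncard)
    (hA : IsCMTypeRealisation Φ A ι θ) (n : ℕ) :
    HodgeConjectureFor (⨁ fun _ : Fin n => A).dim (⨁ fun _ : Fin n => A).X :=
  hodgeConjectureFor_of_forall_hodgeClassSpan_eq₄ₚ₂ _
    fun m ↦ hodgeClassSpan_pow_eq_divisorClassesSpan_of_forall_intermediateField hp2 hexp hW hQ hL hM hL2 hM2 hA n m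

/-- **No power of such an `A` carries an exceptional Hodge class.** [cite: Gordon1999HodgeAVSurvey, Thm. 6.4] -/
theorem not_exists_exceptional_pow_of_forall_intermediateField [Fact p.Prime] (hp2 : p ≠ 2)
    (hexp : ∀ g : K ≃ₐ[ℚ] K, g ^ (4 * p ^ 2) = 1)
    (hW : ∀ F : IntermediateField ℚ K, Module.finrank ℚ F = 2 → ¬ IsTotallyReal F →
        ¬ ∀ τ : F →+* ℂ, {φ : K →+* ℂ | φ.comp (algebraMap F K) = τ ∧ φ ∈ Φ.1}.ncard =
          {φ : K →+* ℂ | φ.comp (algebraMap F K) = τ ∧ φ ∉ Φ.1}.ncard)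
    (hQ : ∀ F : IntermediateField ℚ K, Module.finrank ℚ F = 4 → ¬ IsTotallyReal F → IsCyclic (F ≃ₐ[ℚ] F) →
        ¬ ∀ τ : F →+* ℂ, 2 * {φ : K →+* ℂ | φ.comp (algebraMap F K) = τ ∧ φ ∈ Φ.1}.ncard = Module.finrank F K)
    (hL : ∀ F : IntermediateField ℚ K, Module.finrank ℚ F = 2 * p → ¬ IsTotallyReal F →
        ¬ ∀ σ : F ≃ₐ[ℚ] F, σ ^ p = 1 → ∀ τ : F →+* ℂ,
          {φ : K →+* ℂ | φ.comp (algebraMap F K) = τ.comp σ.toRingEquiv.toRingHom ∧ φ ∈ Φ.1}.ncard =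
            {φ : K →+* ℂ | φ.comp (algebraMap F K) = τ ∧ φ ∈ Φ.1}.ncard)
    (hM : ∀ F : IntermediateField ℚ K, Module.finrank ℚ F = 4 * p → ¬ IsTotallyReal F → IsCyclic (F ≃ₐ[ℚ] F) →
        ¬ ∀ σ : F ≃ₐ[ℚ] F, σ ^ p = 1 → ∀ τ : F →+* ℂ,
          {φ : K →+* ℂ | φ.comp (algebraMap F K) = τ.comp σ.toRingEquiv.toRingHom ∧ φ ∈ Φ.1}.ncard =
            {φ : K →+* ℂ | φ.comp (algebraMap F K) = τ ∧ φ ∈ Φ.1}.ncard)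
    (hL2 : ∀ F : IntermediateField ℚ K, Module.finrank ℚ F = 2 * p ^ 2 → ¬ IsTotallyReal F → IsCyclic (F ≃ₐ[ℚ] F) →
        ¬ ∀ σ : F ≃ₐ[ℚ] F, σ ^ p = 1 → ∀ τ : F →+* ℂ,
          {φ : K →+* ℂ | φ.comp (algebraMap F K) = τ.comp σ.toRingEquiv.toRingHom ∧ φ ∈ Φ.1}.ncard =
            {φ : K →+* ℂ | φ.comp (algebraMap F K) = τ ∧ φ ∈ Φ.1}.ncard)
    (hM2 : ∀ F : IntermediateField ℚ K, Module.finrank ℚ F = 4 * p ^ 2 → ¬ IsTotallyReal F → IsCyclic (F ≃ₐ[ℚ] F) →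
        ¬ ∀ σ : F ≃ₐ[ℚ] F, σ ^ p = 1 → ∀ τ : F →+* ℂ,
          {φ : K →+* ℂ | φ.comp (algebraMap F K) = τ.comp σ.toRingEquiv.toRingHom ∧ φ ∈ Φ.1}.ncard =
            {φ : K →+* ℂ | φ.comp (algebraMap F K) = τ ∧ φ ∈ Φ.1}.ncard)
    (hA : IsCMTypeRealisation Φ A ι θ) (n m : ℕ) :
    ¬ ∃ c : complexBetti (⨁ fun _ : Fin n => A).X (2 * m), IsRationalClass c ∧
        IsOfHodgeType (⨁ fun _ : Fin n => A).dim (⨁ fun _ : Fin n => A).X (2 * m) m m c ∧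
        c ∉ divisorClassesSpan (⨁ fun _ : Fin n => A).X (⨁ fun _ : Fin n => A).dim m := by
  rintro ⟨c, hcQ, hcH, hcD⟩
  exact hcD ((hodgeClassSpan_pow_eq_divisorClassesSpan_of_forall_intermediateField hp2 hexp hW hQ hL hM hL2 hM2 hA n m) ▸
    Submodule.subset_span ⟨hcQ, hcH⟩)

end Varieties

/-! ## §4 The cyclotomic fields `ℚ(ζ_q)` with `(ℤ/q)ˣ` of exponent `4p²`: `q = 37, 74` (`ℤ/36`, `φ = 36`) -/

section Cyclotomic

open Literature.AlgebraicGeometry.Motives (AbelianVariety)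
open Literature.AlgebraicGeometry.HodgeTheory
open Literature.AlgebraicGeometry.ComplexMultiplication (IsCMTypeRealisation)
open Literature.AlgebraicGeometry.VanGeemen1994 (hodgeClassSpan)
open Literature.Barriers.HodgeConjecture (divisorClassesSpan)
open _root_.CategoryTheory _root_.CategoryTheory.Limits
open Polynomial

variable {q p : ℕ} {L : Type} [Field L] [NumberField L]
  {Φ : CMType L} {A : AbelianVariety ℂ} {ι : 𝓞 L →+* End A} {θ : L →+* Module.End ℂ (complexBetti A.X 1)}

/-- **The rank formula for `ℚ(ζ_q)`, `(ℤ/q)ˣ` of exponent `4p²`** (six families). [cite: Kubota1965, §4 Lemma 2] [cite: Hazama2003CyclicCM, Prop. 4.3]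
[cite: Dodson1984, §3.1.1 Theorem] [cite: Dodson1987, Prop. 4.4] [cite: Gordon1999HodgeAVSurvey, 9.4.3] -/
theorem cmTypeRank_add_ncard_subfields_eq_of_isCyclotomicExtension [NeZero q] [IsCyclotomicExtension {q} ℚ L]
    (h2q : 2 < q) [Fact p.Prime] (hp2 : p ≠ 2) (hq : ∀ u : (ZMod q)ˣ, u ^ (4 * p ^ 2) = 1) (Φ : CMType L) :
    cmTypeRank Φ + {F : IntermediateField ℚ L | Module.finrank ℚ F = 2 ∧ ¬ IsTotallyReal F ∧
        ∀ τ : F →+* ℂ, {φ : L →+* ℂ | φ.comp (algebraMap F L) = τ ∧ φ ∈ Φ.1}.ncard =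
          {φ : L →+* ℂ | φ.comp (algebraMap F L) = τ ∧ φ ∉ Φ.1}.ncard}.ncard +
      2 * {F : IntermediateField ℚ L | Module.finrank ℚ F = 4 ∧ ¬ IsTotallyReal F ∧ IsCyclic (F ≃ₐ[ℚ] F) ∧
        ∀ τ : F →+* ℂ, 2 * {φ : L →+* ℂ | φ.comp (algebraMap F L) = τ ∧ φ ∈ Φ.1}.ncard = Module.finrank F L}.ncard +
      (p - 1) * {F : IntermediateField ℚ L | Module.finrank ℚ F = 2 * p ∧ ¬ IsTotallyReal F ∧
        ∀ σ : F ≃ₐ[ℚ] F, σ ^ p = 1 → ∀ τ : F →+* ℂ,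
          {φ : L →+* ℂ | φ.comp (algebraMap F L) = τ.comp σ.toRingEquiv.toRingHom ∧ φ ∈ Φ.1}.ncard =
            {φ : L →+* ℂ | φ.comp (algebraMap F L) = τ ∧ φ ∈ Φ.1}.ncard}.ncard +
      2 * (p - 1) * {F : IntermediateField ℚ L | Module.finrank ℚ F = 4 * p ∧ ¬ IsTotallyReal F ∧ IsCyclic (F ≃ₐ[ℚ] F) ∧
        ∀ σ : F ≃ₐ[ℚ] F, σ ^ p = 1 → ∀ τ : F →+* ℂ,
          {φ : L →+* ℂ | φ.comp (algebraMap F L) = τ.comp σ.toRingEquiv.toRingHom ∧ φ ∈ Φ.1}.ncard =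
            {φ : L →+* ℂ | φ.comp (algebraMap F L) = τ ∧ φ ∈ Φ.1}.ncard}.ncard +
      p * (p - 1) * {F : IntermediateField ℚ L | Module.finrank ℚ F = 2 * p ^ 2 ∧ ¬ IsTotallyReal F ∧ IsCyclic (F ≃ₐ[ℚ] F) ∧
        ∀ σ : F ≃ₐ[ℚ] F, σ ^ p = 1 → ∀ τ : F →+* ℂ,
          {φ : L →+* ℂ | φ.comp (algebraMap F L) = τ.comp σ.toRingEquiv.toRingHom ∧ φ ∈ Φ.1}.ncard =
            {φ : L →+* ℂ | φ.comp (algebraMap F L) = τ ∧ φ ∈ Φ.1}.ncard}.ncard +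
      2 * (p * (p - 1)) * {F : IntermediateField ℚ L | Module.finrank ℚ F = 4 * p ^ 2 ∧ ¬ IsTotallyReal F ∧ IsCyclic (F ≃ₐ[ℚ] F) ∧
        ∀ σ : F ≃ₐ[ℚ] F, σ ^ p = 1 → ∀ τ : F →+* ℂ,
          {φ : L →+* ℂ | φ.comp (algebraMap F L) = τ.comp σ.toRingEquiv.toRingHom ∧ φ ∈ Φ.1}.ncard =
            {φ : L →+* ℂ | φ.comp (algebraMap F L) = τ ∧ φ ∈ Φ.1}.ncard}.ncard = Nat.totient q / 2 + 1 := by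
  obtain ⟨hcm, hab, hexp, hL⟩ := cm_abelian_pow_eq_one_of_isCyclotomicExtension h2q hq L
  haveI := hcm; haveI := hab
  rw [← hL]
  exact cmTypeRank_add_ncard_subfields_eq hp2 hexp Φ

/-- **Nondegeneracy criterion for `ℚ(ζ_q)`, `(ℤ/q)ˣ` of exponent `4p²`.** [cite: Kubota1965, §4 Lemma 2] [cite: Hazama2003CyclicCM, Prop. 4.3]
[cite: Dodson1984, §3.1.1 Theorem] [cite: Dodson1987, Prop. 4.4] [cite: Gordon1999HodgeAVSurvey, 9.4.3] -/
theorem isNondegenerate_iff_of_isCyclotomicExtension [NeZero q] [IsCyclotomicExtension {q} ℚ L]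
    (h2q : 2 < q) [Fact p.Prime] (hp2 : p ≠ 2) (hq : ∀ u : (ZMod q)ˣ, u ^ (4 * p ^ 2) = 1) (Φ : CMType L) :
    IsNondegenerate Φ ↔
      (∀ F : IntermediateField ℚ L, Module.finrank ℚ F = 2 → ¬ IsTotallyReal F →
        ¬ ∀ τ : F →+* ℂ, {φ : L →+* ℂ | φ.comp (algebraMap F L) = τ ∧ φ ∈ Φ.1}.ncard =
          {φ : L →+* ℂ | φ.comp (algebraMap F L) = τ ∧ φ ∉ Φ.1}.ncard) ∧
      (∀ F : IntermediateField ℚ L, Module.finrank ℚ F = 4 → ¬ IsTotallyReal F → IsCyclic (F ≃ₐ[ℚ] F) →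
        ¬ ∀ τ : F →+* ℂ, 2 * {φ : L →+* ℂ | φ.comp (algebraMap F L) = τ ∧ φ ∈ Φ.1}.ncard = Module.finrank F L) ∧
      (∀ F : IntermediateField ℚ L, Module.finrank ℚ F = 2 * p → ¬ IsTotallyReal F →
        ¬ ∀ σ : F ≃ₐ[ℚ] F, σ ^ p = 1 → ∀ τ : F →+* ℂ,
          {φ : L →+* ℂ | φ.comp (algebraMap F L) = τ.comp σ.toRingEquiv.toRingHom ∧ φ ∈ Φ.1}.ncard =
            {φ : L →+* ℂ | φ.comp (algebraMap F L) = τ ∧ φ ∈ Φ.1}.ncard) ∧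
      (∀ F : IntermediateField ℚ L, Module.finrank ℚ F = 4 * p → ¬ IsTotallyReal F → IsCyclic (F ≃ₐ[ℚ] F) →
        ¬ ∀ σ : F ≃ₐ[ℚ] F, σ ^ p = 1 → ∀ τ : F →+* ℂ,
          {φ : L →+* ℂ | φ.comp (algebraMap F L) = τ.comp σ.toRingEquiv.toRingHom ∧ φ ∈ Φ.1}.ncard =
            {φ : L →+* ℂ | φ.comp (algebraMap F L) = τ ∧ φ ∈ Φ.1}.ncard) ∧
      (∀ F : IntermediateField ℚ L, Module.finrank ℚ F = 2 * p ^ 2 → ¬ IsTotallyReal F → IsCyclic (F ≃ₐ[ℚ] F) →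
        ¬ ∀ σ : F ≃ₐ[ℚ] F, σ ^ p = 1 → ∀ τ : F →+* ℂ,
          {φ : L →+* ℂ | φ.comp (algebraMap F L) = τ.comp σ.toRingEquiv.toRingHom ∧ φ ∈ Φ.1}.ncard =
            {φ : L →+* ℂ | φ.comp (algebraMap F L) = τ ∧ φ ∈ Φ.1}.ncard) ∧
      (∀ F : IntermediateField ℚ L, Module.finrank ℚ F = 4 * p ^ 2 → ¬ IsTotallyReal F → IsCyclic (F ≃ₐ[ℚ] F) →
        ¬ ∀ σ : F ≃ₐ[ℚ] F, σ ^ p = 1 → ∀ τ : F →+* ℂ,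
          {φ : L →+* ℂ | φ.comp (algebraMap F L) = τ.comp σ.toRingEquiv.toRingHom ∧ φ ∈ Φ.1}.ncard =
            {φ : L →+* ℂ | φ.comp (algebraMap F L) = τ ∧ φ ∈ Φ.1}.ncard) := by
  obtain ⟨hcm, hab, hexp, -⟩ := cm_abelian_pow_eq_one_of_isCyclotomicExtension h2q hq L
  haveI := hcm; haveI := hab
  exact isNondegenerate_iff_forall_intermediateField hp2 hexp Φ

/-- **The Hodge conjecture for all powers of every realisation of a type of `ℚ(ζ_q)`** (`(ℤ/q)ˣ` of exponent `4p²`) **satisfying the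
six-clause criterion** — UNCONDITIONAL. [cite: Gordon1999HodgeAVSurvey, Thm. 6.4 and §9.3] [cite: Kubota1965, §4 Lemma 2] -/
theorem hodgeConjectureFor_pow_of_forall_of_isCyclotomicExtension [NeZero q] [IsCyclotomicExtension {q} ℚ L]
    (h2q : 2 < q) [Fact p.Prime] (hp2 : p ≠ 2) (hq : ∀ u : (ZMod q)ˣ, u ^ (4 * p ^ 2) = 1)
    (hW : ∀ F : IntermediateField ℚ L, Module.finrank ℚ F = 2 → ¬ IsTotallyReal F →
        ¬ ∀ τ : F →+* ℂ, {φ : L →+* ℂ | φ.comp (algebraMap F L) = τ ∧ φ ∈ Φ.1}.ncard =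
          {φ : L →+* ℂ | φ.comp (algebraMap F L) = τ ∧ φ ∉ Φ.1}.ncard)
    (hQ : ∀ F : IntermediateField ℚ L, Module.finrank ℚ F = 4 → ¬ IsTotallyReal F → IsCyclic (F ≃ₐ[ℚ] F) →
        ¬ ∀ τ : F →+* ℂ, 2 * {φ : L →+* ℂ | φ.comp (algebraMap F L) = τ ∧ φ ∈ Φ.1}.ncard = Module.finrank F L)
    (hL : ∀ F : IntermediateField ℚ L, Module.finrank ℚ F = 2 * p → ¬ IsTotallyReal F →
        ¬ ∀ σ : F ≃ₐ[ℚ] F, σ ^ p = 1 → ∀ τ : F →+* ℂ,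
          {φ : L →+* ℂ | φ.comp (algebraMap F L) = τ.comp σ.toRingEquiv.toRingHom ∧ φ ∈ Φ.1}.ncard =
            {φ : L →+* ℂ | φ.comp (algebraMap F L) = τ ∧ φ ∈ Φ.1}.ncard)
    (hM : ∀ F : IntermediateField ℚ L, Module.finrank ℚ F = 4 * p → ¬ IsTotallyReal F → IsCyclic (F ≃ₐ[ℚ] F) →
        ¬ ∀ σ : F ≃ₐ[ℚ] F, σ ^ p = 1 → ∀ τ : F →+* ℂ,
          {φ : L →+* ℂ | φ.comp (algebraMap F L) = τ.comp σ.toRingEquiv.toRingHom ∧ φ ∈ Φ.1}.ncard =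
            {φ : L →+* ℂ | φ.comp (algebraMap F L) = τ ∧ φ ∈ Φ.1}.ncard)
    (hL2 : ∀ F : IntermediateField ℚ L, Module.finrank ℚ F = 2 * p ^ 2 → ¬ IsTotallyReal F → IsCyclic (F ≃ₐ[ℚ] F) →
        ¬ ∀ σ : F ≃ₐ[ℚ] F, σ ^ p = 1 → ∀ τ : F →+* ℂ,
          {φ : L →+* ℂ | φ.comp (algebraMap F L) = τ.comp σ.toRingEquiv.toRingHom ∧ φ ∈ Φ.1}.ncard =
            {φ : L →+* ℂ | φ.comp (algebraMap F L) = τ ∧ φ ∈ Φ.1}.ncard)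
    (hM2 : ∀ F : IntermediateField ℚ L, Module.finrank ℚ F = 4 * p ^ 2 → ¬ IsTotallyReal F → IsCyclic (F ≃ₐ[ℚ] F) →
        ¬ ∀ σ : F ≃ₐ[ℚ] F, σ ^ p = 1 → ∀ τ : F →+* ℂ,
          {φ : L →+* ℂ | φ.comp (algebraMap F L) = τ.comp σ.toRingEquiv.toRingHom ∧ φ ∈ Φ.1}.ncard =
            {φ : L →+* ℂ | φ.comp (algebraMap F L) = τ ∧ φ ∈ Φ.1}.ncard)
    (hA : IsCMTypeRealisation Φ A ι θ) (n : ℕ) :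
    HodgeConjectureFor (⨁ fun _ : Fin n => A).dim (⨁ fun _ : Fin n => A).X := by
  obtain ⟨hcm, hab, hexp, -⟩ := cm_abelian_pow_eq_one_of_isCyclotomicExtension h2q hq L
  haveI := hcm; haveI := hab
  exact hodgeConjectureFor_pow_of_forall_intermediateField hp2 hexp hW hQ hL hM hL2 hM2 hA n

/-! ### The levels `37, 74` (`ℚ(ζ₃₇) = ℚ(ζ₇₄)`, `(ℤ/q)ˣ ≅ ℤ/36`, `φ(q) = 36`, `p = 3`) -/

/-- `u³⁶ = 1` for every unit of `ℤ/37`: Euler (`φ(37) = 36`; `(ℤ/37)ˣ ≅ ℤ/36` is cyclic of exponent `36 = 4·3²`).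
[cite: Washington1997, Ch. 2 Thm. 2.5] -/
theorem units_pow_thirtySix_thirtySeven (u : (ZMod 37)ˣ) : u ^ (4 * 3 ^ 2) = 1 := by
  have h := ZMod.pow_totient u
  rw [show Nat.totient 37 = 36 by decide] at h
  rw [show (4 * 3 ^ 2 : ℕ) = 36 by norm_num]
  exact h

/-- **`ℚ(ζ₃₇)` (degree `36`, `Gal ≅ ℤ/36` cyclic): `Rank(Φ) + b + 2e₄ + 2e₆ + 4e₁₂ + 6e₁₈ + 12e₃₆ = 19`** for EVERY CM type `Φ`, where
`e_d` counts the CM subfields of degree `d` (with cyclic group, automatic here) over which `Φ` is halved (`d = 4`) ∕ level of exponent `3`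
(`d = 6, 12, 18, 36`) and `b` the Weil imaginary quadratic subfields; on the cyclic field `ℚ(ζ₃₇)` the subfields of degree `2, 6, 18` are REAL
(`ρ = 18 ∈ dℤ/36` iff `d ∣ 18`), so `b = e₆ = e₁₈ = 0` and the formula reads `Rank(Φ) + 2e₄ + 4e₁₂ + 12e₃₆ = 19` (`e₃₆ = 1` iff `Φ` is
stable under the subgroup of order `3`: the imprimitive types). [cite: Kubota1965, §4 Lemma 2] [cite: Hazama2003CyclicCM, Prop. 4.3]
[cite: Dodson1987, Prop. 4.4] [cite: Gordon1999HodgeAVSurvey, 9.4.3] -/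
theorem cmTypeRank_add_ncard_subfields_thirtySeven [IsCyclotomicExtension {37} ℚ L] (Φ : CMType L) :
    cmTypeRank Φ + {F : IntermediateField ℚ L | Module.finrank ℚ F = 2 ∧ ¬ IsTotallyReal F ∧
        ∀ τ : F →+* ℂ, {φ : L →+* ℂ | φ.comp (algebraMap F L) = τ ∧ φ ∈ Φ.1}.ncard =
          {φ : L →+* ℂ | φ.comp (algebraMap F L) = τ ∧ φ ∉ Φ.1}.ncard}.ncard +
      2 * {F : IntermediateField ℚ L | Module.finrank ℚ F = 4 ∧ ¬ IsTotallyReal F ∧ IsCyclic (F ≃ₐ[ℚ] F) ∧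
        ∀ τ : F →+* ℂ, 2 * {φ : L →+* ℂ | φ.comp (algebraMap F L) = τ ∧ φ ∈ Φ.1}.ncard = Module.finrank F L}.ncard +
      2 * {F : IntermediateField ℚ L | Module.finrank ℚ F = 6 ∧ ¬ IsTotallyReal F ∧
        ∀ σ : F ≃ₐ[ℚ] F, σ ^ (3 : ℕ) = AlgEquiv.refl → ∀ τ : F →+* ℂ,
          {φ : L →+* ℂ | φ.comp (algebraMap F L) = τ.comp σ.toRingEquiv.toRingHom ∧ φ ∈ Φ.1}.ncard =
            {φ : L →+* ℂ | φ.comp (algebraMap F L) = τ ∧ φ ∈ Φ.1}.ncard}.ncard +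
      4 * {F : IntermediateField ℚ L | Module.finrank ℚ F = 12 ∧ ¬ IsTotallyReal F ∧ IsCyclic (F ≃ₐ[ℚ] F) ∧
        ∀ σ : F ≃ₐ[ℚ] F, σ ^ (3 : ℕ) = AlgEquiv.refl → ∀ τ : F →+* ℂ,
          {φ : L →+* ℂ | φ.comp (algebraMap F L) = τ.comp σ.toRingEquiv.toRingHom ∧ φ ∈ Φ.1}.ncard =
            {φ : L →+* ℂ | φ.comp (algebraMap F L) = τ ∧ φ ∈ Φ.1}.ncard}.ncard +
      6 * {F : IntermediateField ℚ L | Module.finrank ℚ F = 18 ∧ ¬ IsTotallyReal F ∧ IsCyclic (F ≃ₐ[ℚ] F) ∧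
        ∀ σ : F ≃ₐ[ℚ] F, σ ^ (3 : ℕ) = AlgEquiv.refl → ∀ τ : F →+* ℂ,
          {φ : L →+* ℂ | φ.comp (algebraMap F L) = τ.comp σ.toRingEquiv.toRingHom ∧ φ ∈ Φ.1}.ncard =
            {φ : L →+* ℂ | φ.comp (algebraMap F L) = τ ∧ φ ∈ Φ.1}.ncard}.ncard +
      12 * {F : IntermediateField ℚ L | Module.finrank ℚ F = 36 ∧ ¬ IsTotallyReal F ∧ IsCyclic (F ≃ₐ[ℚ] F) ∧
        ∀ σ : F ≃ₐ[ℚ] F, σ ^ (3 : ℕ) = AlgEquiv.refl → ∀ τ : F →+* ℂ,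
          {φ : L →+* ℂ | φ.comp (algebraMap F L) = τ.comp σ.toRingEquiv.toRingHom ∧ φ ∈ Φ.1}.ncard =
            {φ : L →+* ℂ | φ.comp (algebraMap F L) = τ ∧ φ ∈ Φ.1}.ncard}.ncard = 19 := by
  haveI : Fact (Nat.Prime 3) := ⟨Nat.prime_three⟩
  have h := cmTypeRank_add_ncard_subfields_eq_of_isCyclotomicExtension (L := L) (q := 37) (by norm_num)
    (by decide : (3 : ℕ) ≠ 2) units_pow_thirtySix_thirtySeven Φ
  have hφ : Nat.totient 37 = 36 := by decide
  rw [hφ] at h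
  exact h

/-- **`ℚ(ζ₃₇)`: THE HODGE CONJECTURE FOR ALL POWERS of every abelian variety with complex multiplication by `ℚ(ζ₃₇)` (CM `18`-folds) whose
type halves no cyclic quartic CM subfield and is level of exponent `3` over no CM subfield of degree `12` nor over `ℚ(ζ₃₇)` itself (is
primitive) — the clauses at degrees `2, 6, 18` being void** — UNCONDITIONAL. [cite: Gordon1999HodgeAVSurvey, Thm. 6.4 and §9.3]
[cite: Kubota1965, §4 Lemma 2] -/
theorem hodgeConjectureFor_pow_of_forall_thirtySeven [IsCyclotomicExtension {37} ℚ L]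
    (hW : ∀ F : IntermediateField ℚ L, Module.finrank ℚ F = 2 → ¬ IsTotallyReal F →
        ¬ ∀ τ : F →+* ℂ, {φ : L →+* ℂ | φ.comp (algebraMap F L) = τ ∧ φ ∈ Φ.1}.ncard =
          {φ : L →+* ℂ | φ.comp (algebraMap F L) = τ ∧ φ ∉ Φ.1}.ncard)
    (hQ : ∀ F : IntermediateField ℚ L, Module.finrank ℚ F = 4 → ¬ IsTotallyReal F → IsCyclic (F ≃ₐ[ℚ] F) →
        ¬ ∀ τ : F →+* ℂ, 2 * {φ : L →+* ℂ | φ.comp (algebraMap F L) = τ ∧ φ ∈ Φ.1}.ncard = Module.finrank F L)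
    (hL : ∀ F : IntermediateField ℚ L, Module.finrank ℚ F = 2 * 3 → ¬ IsTotallyReal F →
        ¬ ∀ σ : F ≃ₐ[ℚ] F, σ ^ (3 : ℕ) = AlgEquiv.refl → ∀ τ : F →+* ℂ,
          {φ : L →+* ℂ | φ.comp (algebraMap F L) = τ.comp σ.toRingEquiv.toRingHom ∧ φ ∈ Φ.1}.ncard =
            {φ : L →+* ℂ | φ.comp (algebraMap F L) = τ ∧ φ ∈ Φ.1}.ncard)
    (hM : ∀ F : IntermediateField ℚ L, Module.finrank ℚ F = 4 * 3 → ¬ IsTotallyReal F → IsCyclic (F ≃ₐ[ℚ] F) →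
        ¬ ∀ σ : F ≃ₐ[ℚ] F, σ ^ (3 : ℕ) = AlgEquiv.refl → ∀ τ : F →+* ℂ,
          {φ : L →+* ℂ | φ.comp (algebraMap F L) = τ.comp σ.toRingEquiv.toRingHom ∧ φ ∈ Φ.1}.ncard =
            {φ : L →+* ℂ | φ.comp (algebraMap F L) = τ ∧ φ ∈ Φ.1}.ncard)
    (hL2 : ∀ F : IntermediateField ℚ L, Module.finrank ℚ F = 2 * 3 ^ 2 → ¬ IsTotallyReal F → IsCyclic (F ≃ₐ[ℚ] F) →
        ¬ ∀ σ : F ≃ₐ[ℚ] F, σ ^ (3 : ℕ) = AlgEquiv.refl → ∀ τ : F →+* ℂ,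
          {φ : L →+* ℂ | φ.comp (algebraMap F L) = τ.comp σ.toRingEquiv.toRingHom ∧ φ ∈ Φ.1}.ncard =
            {φ : L →+* ℂ | φ.comp (algebraMap F L) = τ ∧ φ ∈ Φ.1}.ncard)
    (hM2 : ∀ F : IntermediateField ℚ L, Module.finrank ℚ F = 4 * 3 ^ 2 → ¬ IsTotallyReal F → IsCyclic (F ≃ₐ[ℚ] F) →
        ¬ ∀ σ : F ≃ₐ[ℚ] F, σ ^ (3 : ℕ) = AlgEquiv.refl → ∀ τ : F →+* ℂ,
          {φ : L →+* ℂ | φ.comp (algebraMap F L) = τ.comp σ.toRingEquiv.toRingHom ∧ φ ∈ Φ.1}.ncard =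
            {φ : L →+* ℂ | φ.comp (algebraMap F L) = τ ∧ φ ∈ Φ.1}.ncard)
    (hA : IsCMTypeRealisation Φ A ι θ) (n : ℕ) :
    HodgeConjectureFor (⨁ fun _ : Fin n => A).dim (⨁ fun _ : Fin n => A).X :=
  haveI : Fact (Nat.Prime 3) := ⟨Nat.prime_three⟩
  hodgeConjectureFor_pow_of_forall_of_isCyclotomicExtension (q := 37) (by norm_num) (by decide) units_pow_thirtySix_thirtySeven
    hW hQ hL hM hL2 hM2 hA n

/-- `u³⁶ = 1` for every unit of `ℤ/74`: Euler (`φ(74) = 36`; `(ℤ/74)ˣ ≅ ℤ/36` is cyclic of exponent `36 = 4·3²`).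
[cite: Washington1997, Ch. 2 Thm. 2.5] -/
theorem units_pow_thirtySix_seventyFour (u : (ZMod 74)ˣ) : u ^ (4 * 3 ^ 2) = 1 := by
  have h := ZMod.pow_totient u
  rw [show Nat.totient 74 = 36 by decide] at h
  rw [show (4 * 3 ^ 2 : ℕ) = 36 by norm_num]
  exact h

/-- **`ℚ(ζ₇₄)` (degree `36`, `Gal ≅ ℤ/36` cyclic): `Rank(Φ) + b + 2e₄ + 2e₆ + 4e₁₂ + 6e₁₈ + 12e₃₆ = 19`** for EVERY CM type `Φ`, where
`e_d` counts the CM subfields of degree `d` (with cyclic group, automatic here) over which `Φ` is halved (`d = 4`) ∕ level of exponent `3`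
(`d = 6, 12, 18, 36`) and `b` the Weil imaginary quadratic subfields; on the cyclic field `ℚ(ζ₇₄)` the subfields of degree `2, 6, 18` are REAL
(`ρ = 18 ∈ dℤ/36` iff `d ∣ 18`), so `b = e₆ = e₁₈ = 0` and the formula reads `Rank(Φ) + 2e₄ + 4e₁₂ + 12e₃₆ = 19` (`e₃₆ = 1` iff `Φ` is
stable under the subgroup of order `3`: the imprimitive types). [cite: Kubota1965, §4 Lemma 2] [cite: Hazama2003CyclicCM, Prop. 4.3]
[cite: Dodson1987, Prop. 4.4] [cite: Gordon1999HodgeAVSurvey, 9.4.3] -/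
theorem cmTypeRank_add_ncard_subfields_seventyFour [IsCyclotomicExtension {74} ℚ L] (Φ : CMType L) :
    cmTypeRank Φ + {F : IntermediateField ℚ L | Module.finrank ℚ F = 2 ∧ ¬ IsTotallyReal F ∧
        ∀ τ : F →+* ℂ, {φ : L →+* ℂ | φ.comp (algebraMap F L) = τ ∧ φ ∈ Φ.1}.ncard =
          {φ : L →+* ℂ | φ.comp (algebraMap F L) = τ ∧ φ ∉ Φ.1}.ncard}.ncard +
      2 * {F : IntermediateField ℚ L | Module.finrank ℚ F = 4 ∧ ¬ IsTotallyReal F ∧ IsCyclic (F ≃ₐ[ℚ] F) ∧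
        ∀ τ : F →+* ℂ, 2 * {φ : L →+* ℂ | φ.comp (algebraMap F L) = τ ∧ φ ∈ Φ.1}.ncard = Module.finrank F L}.ncard +
      2 * {F : IntermediateField ℚ L | Module.finrank ℚ F = 6 ∧ ¬ IsTotallyReal F ∧
        ∀ σ : F ≃ₐ[ℚ] F, σ ^ (3 : ℕ) = AlgEquiv.refl → ∀ τ : F →+* ℂ,
          {φ : L →+* ℂ | φ.comp (algebraMap F L) = τ.comp σ.toRingEquiv.toRingHom ∧ φ ∈ Φ.1}.ncard =
            {φ : L →+* ℂ | φ.comp (algebraMap F L) = τ ∧ φ ∈ Φ.1}.ncard}.ncard +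
      4 * {F : IntermediateField ℚ L | Module.finrank ℚ F = 12 ∧ ¬ IsTotallyReal F ∧ IsCyclic (F ≃ₐ[ℚ] F) ∧
        ∀ σ : F ≃ₐ[ℚ] F, σ ^ (3 : ℕ) = AlgEquiv.refl → ∀ τ : F →+* ℂ,
          {φ : L →+* ℂ | φ.comp (algebraMap F L) = τ.comp σ.toRingEquiv.toRingHom ∧ φ ∈ Φ.1}.ncard =
            {φ : L →+* ℂ | φ.comp (algebraMap F L) = τ ∧ φ ∈ Φ.1}.ncard}.ncard +
      6 * {F : IntermediateField ℚ L | Module.finrank ℚ F = 18 ∧ ¬ IsTotallyReal F ∧ IsCyclic (F ≃ₐ[ℚ] F) ∧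
        ∀ σ : F ≃ₐ[ℚ] F, σ ^ (3 : ℕ) = AlgEquiv.refl → ∀ τ : F →+* ℂ,
          {φ : L →+* ℂ | φ.comp (algebraMap F L) = τ.comp σ.toRingEquiv.toRingHom ∧ φ ∈ Φ.1}.ncard =
            {φ : L →+* ℂ | φ.comp (algebraMap F L) = τ ∧ φ ∈ Φ.1}.ncard}.ncard +
      12 * {F : IntermediateField ℚ L | Module.finrank ℚ F = 36 ∧ ¬ IsTotallyReal F ∧ IsCyclic (F ≃ₐ[ℚ] F) ∧
        ∀ σ : F ≃ₐ[ℚ] F, σ ^ (3 : ℕ) = AlgEquiv.refl → ∀ τ : F →+* ℂ,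
          {φ : L →+* ℂ | φ.comp (algebraMap F L) = τ.comp σ.toRingEquiv.toRingHom ∧ φ ∈ Φ.1}.ncard =
            {φ : L →+* ℂ | φ.comp (algebraMap F L) = τ ∧ φ ∈ Φ.1}.ncard}.ncard = 19 := by
  haveI : Fact (Nat.Prime 3) := ⟨Nat.prime_three⟩
  have h := cmTypeRank_add_ncard_subfields_eq_of_isCyclotomicExtension (L := L) (q := 74) (by norm_num)
    (by decide : (3 : ℕ) ≠ 2) units_pow_thirtySix_seventyFour Φ
  have hφ : Nat.totient 74 = 36 := by decide
  rw [hφ] at h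
  exact h

/-- **`ℚ(ζ₇₄)`: THE HODGE CONJECTURE FOR ALL POWERS of every abelian variety with complex multiplication by `ℚ(ζ₇₄)` (CM `18`-folds) whose
type halves no cyclic quartic CM subfield and is level of exponent `3` over no CM subfield of degree `12` nor over `ℚ(ζ₇₄)` itself (is
primitive) — the clauses at degrees `2, 6, 18` being void** — UNCONDITIONAL. [cite: Gordon1999HodgeAVSurvey, Thm. 6.4 and §9.3]
[cite: Kubota1965, §4 Lemma 2] -/
theorem hodgeConjectureFor_pow_of_forall_seventyFour [IsCyclotomicExtension {74} ℚ L]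
    (hW : ∀ F : IntermediateField ℚ L, Module.finrank ℚ F = 2 → ¬ IsTotallyReal F →
        ¬ ∀ τ : F →+* ℂ, {φ : L →+* ℂ | φ.comp (algebraMap F L) = τ ∧ φ ∈ Φ.1}.ncard =
          {φ : L →+* ℂ | φ.comp (algebraMap F L) = τ ∧ φ ∉ Φ.1}.ncard)
    (hQ : ∀ F : IntermediateField ℚ L, Module.finrank ℚ F = 4 → ¬ IsTotallyReal F → IsCyclic (F ≃ₐ[ℚ] F) →
        ¬ ∀ τ : F →+* ℂ, 2 * {φ : L →+* ℂ | φ.comp (algebraMap F L) = τ ∧ φ ∈ Φ.1}.ncard = Module.finrank F L)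
    (hL : ∀ F : IntermediateField ℚ L, Module.finrank ℚ F = 2 * 3 → ¬ IsTotallyReal F →
        ¬ ∀ σ : F ≃ₐ[ℚ] F, σ ^ (3 : ℕ) = AlgEquiv.refl → ∀ τ : F →+* ℂ,
          {φ : L →+* ℂ | φ.comp (algebraMap F L) = τ.comp σ.toRingEquiv.toRingHom ∧ φ ∈ Φ.1}.ncard =
            {φ : L →+* ℂ | φ.comp (algebraMap F L) = τ ∧ φ ∈ Φ.1}.ncard)
    (hM : ∀ F : IntermediateField ℚ L, Module.finrank ℚ F = 4 * 3 → ¬ IsTotallyReal F → IsCyclic (F ≃ₐ[ℚ] F) →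
        ¬ ∀ σ : F ≃ₐ[ℚ] F, σ ^ (3 : ℕ) = AlgEquiv.refl → ∀ τ : F →+* ℂ,
          {φ : L →+* ℂ | φ.comp (algebraMap F L) = τ.comp σ.toRingEquiv.toRingHom ∧ φ ∈ Φ.1}.ncard =
            {φ : L →+* ℂ | φ.comp (algebraMap F L) = τ ∧ φ ∈ Φ.1}.ncard)
    (hL2 : ∀ F : IntermediateField ℚ L, Module.finrank ℚ F = 2 * 3 ^ 2 → ¬ IsTotallyReal F → IsCyclic (F ≃ₐ[ℚ] F) →
        ¬ ∀ σ : F ≃ₐ[ℚ] F, σ ^ (3 : ℕ) = AlgEquiv.refl → ∀ τ : F →+* ℂ,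
          {φ : L →+* ℂ | φ.comp (algebraMap F L) = τ.comp σ.toRingEquiv.toRingHom ∧ φ ∈ Φ.1}.ncard =
            {φ : L →+* ℂ | φ.comp (algebraMap F L) = τ ∧ φ ∈ Φ.1}.ncard)
    (hM2 : ∀ F : IntermediateField ℚ L, Module.finrank ℚ F = 4 * 3 ^ 2 → ¬ IsTotallyReal F → IsCyclic (F ≃ₐ[ℚ] F) →
        ¬ ∀ σ : F ≃ₐ[ℚ] F, σ ^ (3 : ℕ) = AlgEquiv.refl → ∀ τ : F →+* ℂ,
          {φ : L →+* ℂ | φ.comp (algebraMap F L) = τ.comp σ.toRingEquiv.toRingHom ∧ φ ∈ Φ.1}.ncard =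
            {φ : L →+* ℂ | φ.comp (algebraMap F L) = τ ∧ φ ∈ Φ.1}.ncard)
    (hA : IsCMTypeRealisation Φ A ι θ) (n : ℕ) :
    HodgeConjectureFor (⨁ fun _ : Fin n => A).dim (⨁ fun _ : Fin n => A).X :=
  haveI : Fact (Nat.Prime 3) := ⟨Nat.prime_three⟩
  hodgeConjectureFor_pow_of_forall_of_isCyclotomicExtension (q := 74) (by norm_num) (by decide) units_pow_thirtySix_seventyFour
    hW hQ hL hM hL2 hM2 hA n

end Cyclotomic

end ExponentFourTimesPrimeSquare

end Literature.AlgebraicGeometry.Pohlmann1968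

end
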